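import Literature.Geometry.Lorentzian.MassCapacityProofs
import Literature.Geometry.Lorentzian.GreenIdentityCompactSupport
import HarnessLib

/-!
# The capacity of a horizon is attained by its harmonic potential (Bray 2001, §6, (85)–(86))

Companion file of `MassCapacity.lean` / `MassCapacityProofs.lean` on the discharge path of the
named fact `Bray2001_mass_ge_half_capacity` (Bray, J. Differential Geom. 59 (2001), Thm. 9):
the capacity `ℰ(Σ, g) = inf_φ (1/2π) ∫ |∇φ|²` of Def. 17 (`horizonCapacity`) enters the mass
through its minimiser, *"the Green's function `φ(x)` which satisfies (86): `lim_{x→∞} φ = 1`,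
`Δφ = 0`, `φ = 0` on `Σ`"*, with `φ = 1 - ℰ(Σ, g)/(2|x|) + O(|x|⁻²)` (87). This file proves, with
the tree's intrinsic objects (the Laplace–Beltrami operator `dalembertian = tr_h Hess`, the
inverse metric `innerDual`, the Riemannian measure, Green's first identity of
`GreenIdentityCompactSupport.lean`) and **without boundary integrals**, that a harmonic
potential with the properties (86) *does* realise the infimum:

* `horizonCapacity_eq_of_harmonic` — **main theorem**: if `U` is an exterior region of the end
  `e` and `φ₀` is a test function of the capacity (continuous, smooth on `U`, `0` on `Σ = ∂U` and
  inside, `→ 1` at infinity) which is `h`-harmonic on `U` with `0 < φ₀ < 1` and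
  `∫_U |∇φ₀|² < ∞`, then `horizonCapacity h e U = (1/2π) ∫_U |∇φ₀|²_h dV_h`;
  `setLIntegral_gradNorm_sq_le_dirichletEnergy_of_harmonic` (the Dirichlet principle
  `∫_U |∇φ₀|² ≤ ∫ |∇φ|²` for every test function `φ`) and
  `horizonCapacity_toReal_eq_of_harmonic` (the real-number form used by Thm. 9).

Existence, uniqueness and boundary regularity of (86) are **not** asserted (no named facts are
introduced); the theorem identifies `ℰ(Σ, g)` once the potential is given. The proof:

1. *Locality and orthogonality* (any Riemannian manifold modelled on `ℝ^m`):
   `PseudoRiemannianMetric.hessian_congr_of_eventuallyEq`, `dalembertian_congr_of_eventuallyEq`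
   (the Hessian and `Δ_h` see only germs); `exists_contMDiff_hasCompactSupport_eventuallyEq`
   (globalisation of a function `C^n` on an open `U` near a compact `K ⊆ U` by a smooth bump);
   `continuousOn_innerDual_mvfderiv`; and
   `integral_innerDual_mvfderiv_eq_zero_of_dalembertian_eq_zero` — **a function harmonic on `U`
   is energy-orthogonal to `C¹` variations compactly supported in `U`**:
   `∫ h⁻¹(dψ, dφ₀) dV_h = 0` (Green's identity for the compactly supported `ψ` against the
   globalisation of `φ₀`).
2. *The comparison class* (`3`-manifolds with an end `e`): the capacity is the infimum of
   `(1/2π) ∫ |∇φ|²` over smooth `φ` with `tsupport φ ⊆ U` (`horizonCapacity_eq_iInf_tsupport_subset`,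
   the truncations near `Σ` of `MassCapacityProofs.lean` vanish *near* `X ∖ U`) which moreover
   equal `1` on a far region of the end (`horizonCapacity_eq_iInf_eqOn_far`, by the truncation
   `1 - G_δ ∘ (1 - φ)` at level `1`, `dirichletEnergy_levelOne_trunc_le`, and continuity from
   above along the shrinking collars `{0 < |1 - φ| ≤ 2δ}`). Differences of two comparison
   functions are smooth with compact support in `U`
   (`IsExteriorRegion.isCompact_closure_diff_far`: an exterior region is compact modulo every
   far region).
3. *Constancy of the pairing*: `L(φ) = ∫ h⁻¹(dφ, dφ₀)` is a continuous compactly supported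
   integral (`continuous_pairing_of_eqOn_far`) taking the same value on all comparison functions
   (`integral_pairing_eq_of_eqOn_far`, step 1 applied to their differences).
4. *Evaluation on double truncations of the potential*: `W_δ ∘ φ₀` (`W_δ = 0` near `0`, `= 1`
   near `1`, `W_δ' → 1` on `(0, 1)`, `|W_δ'| ≤ C`; `exists_smooth_doubleTruncation`,
   `IsCapacityTestFn.doubleTrunc_mem`) are comparison functions with
   `L(W_δ ∘ φ₀) = ∫_U W_δ'(φ₀) |∇φ₀|² → ∫_U |∇φ₀|²` and
   `∫ |∇(W_δ ∘ φ₀)|² = ∫_U W_δ'(φ₀)² |∇φ₀|² → ∫_U |∇φ₀|²` (dominated convergence,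
   `tendsto_setIntegral_mul_of_eventually_eq_one`); hence `L ≡ ∫_U |∇φ₀|²`, the capacity is at
   most `(1/2π) ∫_U |∇φ₀|²`, and for every comparison `φ` the expansion
   `|∇φ|² = |∇φ₀|² + 2 (h⁻¹(dφ, dφ₀) - |∇φ₀|²) + |∇(φ - φ₀)|²` (`gradNorm_sq_expand`) integrates to
   `∫_U |∇φ|² = ∫_U |∇φ₀|² + ∫_U |∇(φ - φ₀)|² ≥ ∫_U |∇φ₀|²`.

Everything is proved; there are no definitions and no named facts. Hypotheses: `X` a `C^∞`
`3`-manifold modelled on `E3`, Hausdorff, locally compact, σ-compact, with a Borel σ-algebra;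
`h` a smooth Riemannian metric with `[(ofRiemannian h).HasLeviCivita]` (always available).

## References

* H. L. Bray, *Proof of the Riemannian Penrose inequality using the positive mass theorem*,
  J. Differential Geom. 59 (2001) 177–267 (arXiv:math/9911173), §6, Def. 17 (85) and the
  Green's function (86)–(87) (key `BrayRPI2001`).
* J. M. Lee, *Introduction to Riemannian Manifolds*, 2nd ed., GTM 176, Springer 2018,
  Problem 2-23 (a) (Green's first identity) (key `Lee2018`).
* B. O'Neill, *Semi-Riemannian geometry*, Academic Press 1983, Ch. 3, Def. 3.48–3.50 (Hessian
  and Laplacian) (key `ONeill1983`).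
-/

noncomputable section

open Bundle Set Function Manifold TopologicalSpace Filter MeasureTheory
open scoped ContDiff Topology ENNReal Manifold Real

namespace Literature.Geometry.Lorentzian

/-! ### Locality of the Hessian and of the Laplace–Beltrami operator (congruence form) -/

namespace PseudoRiemannianMetric

section Locality

variable {E : Type*} [NormedAddCommGroup E] [NormedSpace ℝ E] {H : Type*} [TopologicalSpace H]
  {I : ModelWithCorners ℝ E H} {M : Type*} [TopologicalSpace M] [ChartedSpace H M]
  [IsManifold I ∞ M] {n : ℕ∞ω} [Fact (1 ≤ n)] [FiniteDimensional ℝ E] [CompleteSpace E]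
  (g : PseudoRiemannianMetric I n E (TangentSpace I : M → Type _)) [g.HasLeviCivita]

omit [FiniteDimensional ℝ E] [CompleteSpace E] [Fact (1 ≤ n)] in
/-- The bare Hessian operation `X(Yf)(x) − ((∇_X Y) f)(x)` depends only on the germ of `f` at `x`.
[folklore] -/
theorem hessianAux_congr_of_eventuallyEq {f f' : M → ℝ} {x : M} (hf : f =ᶠ[𝓝 x] f')
    (X Y : Π x : M, TangentSpace I x) :
    g.hessianAux f X Y x = g.hessianAux f' X Y x := by
  have h1 : (fun y ↦ mvfderiv I f y (Y y)) =ᶠ[𝓝 x] fun y ↦ mvfderiv I f' y (Y y) := by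
    filter_upwards [hf.eventuallyEq_nhds] with y hy
    rw [mvfderiv_congr_of_eventuallyEq hy]
  rw [PseudoRiemannianMetric.hessianAux, PseudoRiemannianMetric.hessianAux,
    mvfderiv_congr_of_eventuallyEq h1, mvfderiv_congr_of_eventuallyEq hf]

omit [FiniteDimensional ℝ E] [CompleteSpace E] [Fact (1 ≤ n)] in
/-- **Locality of the Hessian**: functions agreeing near `x` have the same Hessian at `x`
(O'Neill 1983, Ch. 3, Def. 3.48: `Hess f = ∇(df)` is built from the germ of `f`).
[cite: ONeill1983, Ch. 3, Def. 3.48] -/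
theorem hessian_congr_of_eventuallyEq {f f' : M → ℝ} {x : M} (hf : f =ᶠ[𝓝 x] f') :
    g.hessian f x = g.hessian f' x := by
  have key : (fun (X Y : Π x : M, TangentSpace I x) ↦ g.hessianAux f X Y x) =
      fun X Y ↦ g.hessianAux f' X Y x := by
    funext X Y
    exact g.hessianAux_congr_of_eventuallyEq hf X Y
  unfold PseudoRiemannianMetric.hessian
  classical
  exact congrArg (fun A : (Π x : M, TangentSpace I x) → (Π x : M, TangentSpace I x) → ℝ ↦
    if h : ∃ B : LinearMap.BilinForm ℝ (TangentSpace I x), ∀ X₀ Y₀ : TangentSpace I x,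
      B X₀ Y₀ = A (FiberBundle.extend E X₀) (FiberBundle.extend E Y₀) then h.choose else 0) key

omit [CompleteSpace E] [Fact (1 ≤ n)] in
/-- **Locality of the Laplace–Beltrami operator**: functions agreeing near `x` have the same
`Δ_g = tr_g Hess` at `x` (O'Neill 1983, Ch. 3, Def. 3.50). [cite: ONeill1983, Ch. 3, Def. 3.50] -/
theorem dalembertian_congr_of_eventuallyEq {f f' : M → ℝ} {x : M} (hf : f =ᶠ[𝓝 x] f') :
    g.dalembertian f x = g.dalembertian f' x := by
  simp only [PseudoRiemannianMetric.dalembertian, g.hessian_congr_of_eventuallyEq hf]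

end Locality

end PseudoRiemannianMetric

open PseudoRiemannianMetric

/-! ### Globalisation of functions smooth on an open set -/

section Globalise

variable {E : Type*} [NormedAddCommGroup E] [NormedSpace ℝ E] [FiniteDimensional ℝ E]
  {H : Type*} [TopologicalSpace H] {I : ModelWithCorners ℝ E H}
  {M : Type*} [TopologicalSpace M] [ChartedSpace H M] [IsManifold I ∞ M]
  [T2Space M] [LocallyCompactSpace M] [SigmaCompactSpace M]

/-- **Globalisation.** If `φ₀` is `C^n` on an open set `U` and `K ⊆ U` is compact, there is a
`C^n` function `f` on `M` with compact support inside `U` which agrees with `φ₀` near every point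
of an open set `V` with `K ⊆ V ⊆ U`: `f = η φ₀` for a smooth bump `η` equal to `1` near `K` and
supported in a compact subset of `U` (nested neighbourhoods
`K ⊆ V₁ ⊆ closure V₁ ⊆ V₂ ⊆ closure V₂ ⊆ U`, Mathlib's `exists_contMDiffMap_zero_one_of_isClosed`).
[folklore] -/
theorem exists_contMDiff_hasCompactSupport_eventuallyEq {n : ℕ∞} {U K : Set M} (hU : IsOpen U)
    (hK : IsCompact K) (hKU : K ⊆ U) {φ₀ : M → ℝ} (hφ₀ : ContMDiffOn I 𝓘(ℝ, ℝ) n φ₀ U) :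
    ∃ f : M → ℝ, ContMDiff I 𝓘(ℝ, ℝ) n f ∧ HasCompactSupport f ∧ tsupport f ⊆ U ∧
      ∃ V : Set M, IsOpen V ∧ K ⊆ V ∧ V ⊆ U ∧ ∀ x ∈ V, f =ᶠ[𝓝 x] φ₀ := by
  -- nested neighbourhoods `K ⊆ V₁ ⊆ closure V₁ ⊆ V₂ ⊆ closure V₂ ⊆ U`
  obtain ⟨V₁, hV₁o, hKV₁, hV₁U, hV₁c⟩ := exists_open_between_and_isCompact_closure hK hU hKU
  obtain ⟨V₂, hV₂o, hV₁V₂, hV₂U, hV₂c⟩ := exists_open_between_and_isCompact_closure hV₁c hU hV₁U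
  -- a smooth `η` with `η = 0` off `V₂` and `η = 1` on `closure V₁`
  obtain ⟨η, hη0, hη1, -⟩ := exists_contMDiffMap_zero_one_of_isClosed (I := I) (n := (⊤ : ℕ∞))
    hV₂o.isClosed_compl isClosed_closure (disjoint_compl_left_iff.2 hV₁V₂)
  set f : M → ℝ := fun p ↦ η p * φ₀ p with hf_def
  have hf0 : ∀ p, p ∉ V₂ → f p = 0 := fun p hp ↦ by
    simp only [hf_def, show η p = 0 from hη0 hp, zero_mul]
  have hsupp : tsupport f ⊆ closure V₂ :=
    closure_mono fun p hp ↦ by_contra fun hp2 ↦ hp (hf0 p hp2)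
  refine ⟨f, fun p ↦ ?_, IsCompact.of_isClosed_subset hV₂c
    (isClosed_tsupport f) hsupp, hsupp.trans hV₂U, V₁, hV₁o, hKV₁,
    subset_closure.trans hV₁U, fun p hp ↦ ?_⟩
  · -- `f` is `C^n` at `p`
    by_cases hp : p ∈ U
    · exact ((η.contMDiff.of_le (WithTop.coe_le_coe.mpr le_top)).contMDiffAt).mul
        (hφ₀.contMDiffAt (hU.mem_nhds hp))
    · have hp2 : p ∉ closure V₂ := fun h2 ↦ hp (hV₂U h2)
      have hev : f =ᶠ[𝓝 p] fun _ ↦ 0 := by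
        filter_upwards [isClosed_closure.isOpen_compl.mem_nhds hp2] with q hq
        exact hf0 q fun h2 ↦ hq (subset_closure h2)
      exact contMDiffAt_const.congr_of_eventuallyEq hev
  · -- `f = φ₀` near `p ∈ V₁`
    filter_upwards [hV₁o.mem_nhds hp] with q hq
    simp only [hf_def, show η q = 1 from hη1 (subset_closure hq), one_mul]

end Globalise

/-! ### Harmonic functions are orthogonal to compactly supported variations -/

section Orthogonality

variable {m : ℕ} {H : Type*} [TopologicalSpace H]
  {I : ModelWithCorners ℝ (EuclideanSpace ℝ (Fin m)) H} [I.Boundaryless]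
  {N : Type*} [TopologicalSpace N] [ChartedSpace H N] [IsManifold I ∞ N]
  [T2Space N] [LocallyCompactSpace N] [SigmaCompactSpace N] [MeasurableSpace N] [BorelSpace N]
  (h : ContMDiffRiemannianMetric I ∞ (EuclideanSpace ℝ (Fin m)) (TangentSpace I : N → Type _))
  [(ofRiemannian h).HasLeviCivita]

omit [MeasurableSpace N] [BorelSpace N] [(ofRiemannian h).HasLeviCivita] in
/-- **`h⁻¹(du, dv)` is continuous on an open set on which `u, v` are `C¹`** (the global
statement `continuous_innerDual_mvfderiv` of `ChartLaplacian.lean`, localised by globalisation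
at each point). [folklore] -/
theorem continuousOn_innerDual_mvfderiv {U : Set N} (hU : IsOpen U) {u v : N → ℝ}
    (hu : ContMDiffOn I 𝓘(ℝ, ℝ) 1 u U) (hv : ContMDiffOn I 𝓘(ℝ, ℝ) 1 v U) :
    ContinuousOn (fun p ↦ (ofRiemannian h).innerDual p (mvfderiv I u p).toLinearMap
      (mvfderiv I v p).toLinearMap) U := by
  intro x hx
  obtain ⟨fu, hfu, -, -, Vu, hVuo, hxVu, -, hfuV⟩ :=
    exists_contMDiff_hasCompactSupport_eventuallyEq (n := 1) hU isCompact_singleton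
      (singleton_subset_iff.2 hx) hu
  obtain ⟨fv, hfv, -, -, Vv, hVvo, hxVv, -, hfvV⟩ :=
    exists_contMDiff_hasCompactSupport_eventuallyEq (n := 1) hU isCompact_singleton
      (singleton_subset_iff.2 hx) hv
  have hc := (continuous_innerDual_mvfderiv (ofRiemannian h) hfu hfv).continuousAt (x := x)
  refine (hc.congr ?_).continuousWithinAt
  filter_upwards [hVuo.mem_nhds (singleton_subset_iff.1 hxVu),
    hVvo.mem_nhds (singleton_subset_iff.1 hxVv)] with y hyu hyv
  rw [mvfderiv_congr_of_eventuallyEq (hfuV y hyu), mvfderiv_congr_of_eventuallyEq (hfvV y hyv)]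

/-- **A function harmonic on an open set is energy-orthogonal to compactly supported variations
inside it.** Let `(N, h)` be a Riemannian manifold modelled on `ℝ^m` (Hausdorff, locally compact,
σ-compact), `U ⊆ N` open, `φ₀ ∈ C²(U)` with `Δ_h φ₀ = 0` on `U`, and `ψ ∈ C¹(N)` with compact
support `tsupport ψ ⊆ U`. Then `∫_N h⁻¹(dψ, dφ₀) dμ_h = 0`. Proof: globalise `φ₀` to `f ∈ C²(N)`
agreeing with `φ₀` near `tsupport ψ` (`exists_contMDiff_hasCompactSupport_eventuallyEq`); Green's
first identity for the compactly supported `ψ`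
(`integral_mul_dalembertian_eq_neg_integral_innerDual_of_hasCompactSupport`) gives
`∫ h⁻¹(dψ, df) = −∫ ψ Δ_h f = −∫ ψ Δ_h φ₀ = 0` (locality of `Δ_h`), while
`h⁻¹(dψ, df) = h⁻¹(dψ, dφ₀)` everywhere (`df = dφ₀` near `tsupport ψ`, `dψ = 0` off it). This is
the vanishing of the first variation of the Dirichlet energy at a harmonic function (Bray 2001,
§6: "the infimum … is achieved by the Green's function"). [cite: Lee2018, Problem 2-23 (a)] -/
theorem integral_innerDual_mvfderiv_eq_zero_of_dalembertian_eq_zero {U : Set N} (hU : IsOpen U)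
    {φ₀ ψ : N → ℝ} (hφ₀ : ContMDiffOn I 𝓘(ℝ, ℝ) 2 φ₀ U)
    (hΔ : ∀ x ∈ U, (ofRiemannian h).dalembertian φ₀ x = 0)
    (hψ : ContMDiff I 𝓘(ℝ, ℝ) 1 ψ) (hψc : HasCompactSupport ψ) (hsupp : tsupport ψ ⊆ U) :
    ∫ p, (ofRiemannian h).innerDual p (mvfderiv I ψ p).toLinearMap (mvfderiv I φ₀ p).toLinearMap
      ∂riemannianMeasure h = 0 := by
  obtain ⟨f, hf, -, -, V, hVo, hKV, -, hfφ⟩ :=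
    exists_contMDiff_hasCompactSupport_eventuallyEq (n := 2) hU hψc.isCompact hsupp hφ₀
  have key := integral_mul_dalembertian_eq_neg_integral_innerDual_of_hasCompactSupport h hψ hψc hf
  -- the left integrand vanishes identically
  have hL : (fun p ↦ ψ p * (ofRiemannian h).dalembertian f p) = fun _ ↦ 0 := by
    funext p
    by_cases hp : p ∈ tsupport ψ
    · rw [(ofRiemannian h).dalembertian_congr_of_eventuallyEq (hfφ p (hKV hp)), hΔ p (hsupp hp),
        mul_zero]
    · rw [image_eq_zero_of_notMem_tsupport hp, zero_mul]
  -- the right integrands agree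
  have hR : (fun p ↦ (ofRiemannian h).innerDual p (mvfderiv I ψ p).toLinearMap
      (mvfderiv I f p).toLinearMap) =
      fun p ↦ (ofRiemannian h).innerDual p (mvfderiv I ψ p).toLinearMap
        (mvfderiv I φ₀ p).toLinearMap := by
    funext p
    by_cases hp : p ∈ tsupport ψ
    · rw [mvfderiv_congr_of_eventuallyEq (hfφ p (hKV hp))]
    · rw [mvfderiv_eq_zero_of_notMem_tsupport hp]
      simp [PseudoRiemannianMetric.innerDual]
  rw [hL, hR, integral_zero] at key
  linarith

end Orthogonality

/-! ## The class of smooth comparison functions supported in `U` and equal to `1` far out -/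

section TestClasses

variable {X : Type} [TopologicalSpace X] [ChartedSpace E3 X] [IsManifold (𝓡 3) ∞ X]

section Slope

variable (h : ContMDiffRiemannianMetric (𝓡 3) ∞ E3 (TangentSpace (𝓡 3) : X → Type _))

/-- The slope as the inverse metric on the differential, squared: `|∇u|²_h = h⁻¹(du, du)` with
`du = mvfderiv u` (the form in which Green's identity is stated). [folklore] -/
theorem gradNorm_sq_eq_innerDual_mvfderiv (u : X → ℝ) (x : X) :
    gradNorm h u x ^ 2 = (ofRiemannian h).innerDual x (mvfderiv (𝓡 3) u x).toLinearMap
      (mvfderiv (𝓡 3) u x).toLinearMap := by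
  have hlin : (mvfderiv (𝓡 3) u x).toLinearMap =
      (mfderiv (𝓡 3) 𝓘(ℝ, ℝ) u x).toLinearMap := LinearMap.ext fun _ ↦ rfl
  rw [hlin, gradNorm, Real.sq_sqrt (innerDual_self_nonneg h x _)]

omit [IsManifold (𝓡 3) ∞ X] in
/-- `d(c - u)_x = -du_x` when `u` is differentiable at `x`. [folklore] -/
theorem mfderiv_const_sub {u : X → ℝ} {x : X} (c : ℝ)
    (hu : MDifferentiableAt (𝓡 3) 𝓘(ℝ, ℝ) u x) :
    mfderiv (𝓡 3) 𝓘(ℝ, ℝ) (fun y ↦ c - u y) x = (-1 : ℝ) • mfderiv (𝓡 3) 𝓘(ℝ, ℝ) u x := by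
  have h1 : HasDerivAt (fun s : ℝ ↦ c - s) (-1) (u x) := by
    simpa using (hasDerivAt_id (u x)).const_sub c
  exact (hasMFDerivAt_real_comp (G := fun s ↦ c - s) h1 hu).mfderiv

/-- **The slope of `c - u` is the slope of `u`.** (If `u` is not differentiable at `x`, neither is
`c - u`, and both slopes are the junk value `0`.) [folklore] -/
theorem gradNorm_const_sub (u : X → ℝ) (c : ℝ) (x : X) :
    gradNorm h (fun y ↦ c - u y) x = gradNorm h u x := by
  by_cases hu : MDifferentiableAt (𝓡 3) 𝓘(ℝ, ℝ) u x
  · have h1 : HasDerivAt (fun s : ℝ ↦ c - s) (-1) (u x) := by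
      simpa using (hasDerivAt_id (u x)).const_sub c
    have h2 := gradNorm_real_comp h (G := fun s ↦ c - s) h1 hu
    have h3 : ((fun s : ℝ ↦ c - s) ∘ u) = fun y ↦ c - u y := rfl
    rw [h3] at h2
    simpa using h2
  · have hu' : ¬ MDifferentiableAt (𝓡 3) 𝓘(ℝ, ℝ) (fun y ↦ c - u y) x := fun h' ↦ hu (by
      have h1 : HasDerivAt (fun s : ℝ ↦ c - s) (-1) (c - u x) := by
        simpa using (hasDerivAt_id (c - u x)).const_sub c
      have h2 := (hasMFDerivAt_real_comp (G := fun s ↦ c - s) (φ := fun y ↦ c - u y) h1 h')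
      have h3 : ((fun s : ℝ ↦ c - s) ∘ fun y ↦ c - u y) = u := by
        funext y; simp
      rw [h3] at h2
      exact h2.mdifferentiableAt)
    simp only [gradNorm, mfderiv_zero_of_not_mdifferentiableAt hu,
      mfderiv_zero_of_not_mdifferentiableAt hu']
    rfl

/-- The Dirichlet energy of `c - u` is that of `u`. [folklore] -/
theorem dirichletEnergy_const_sub [T2Space X] [LocallyCompactSpace X] [MeasurableSpace X]
    [BorelSpace X] (u : X → ℝ) (c : ℝ) :
    dirichletEnergy h (fun y ↦ c - u y) = dirichletEnergy h u := by
  simp only [dirichletEnergy, gradNorm_const_sub]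

end Slope

variable {e : AFEnd X} {U : Opens X}
variable [T2Space X] [LocallyCompactSpace X] [MeasurableSpace X] [BorelSpace X]
  (h : ContMDiffRiemannianMetric (𝓡 3) ∞ E3 (TangentSpace (𝓡 3) : X → Type _))

/-- **Energy of a truncation `G ∘ φ` (generic form).** Let `φ : X → ℝ` be continuous and
differentiable at every point of the collar `{0 < |φ| ≤ 2δ}` (`δ > 0`), and let `G` be a
truncation at level `0`: `G = 0` on `[-δ, δ]`, `G(s) = s` for `|s| ≥ 2δ`, `|G'| ≤ C`. Then
`∫ |∇(G ∘ φ)|² ≤ ∫ |∇φ|² + C² ∫_{0 < |φ| ≤ 2δ} |∇φ|²`: pointwise `|∇(G ∘ φ)| = 0` where `|φ| < δ`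
(`G ∘ φ` is locally zero), `= |∇φ|` where `|φ| > 2δ` (`G ∘ φ = φ` locally), and `≤ C |∇φ|` on the
collar (chain rule). (`IsCapacityTestFn.dirichletEnergy_real_comp_le` is the case of a test
function, differentiable off its zero set.) [folklore] -/
theorem dirichletEnergy_real_comp_le_of_mdifferentiableAt {φ : X → ℝ} (hφc : Continuous φ)
    {δ C : ℝ} (hδ : 0 < δ)
    (hφd : ∀ x, 0 < |φ x| → |φ x| ≤ 2 * δ → MDifferentiableAt (𝓡 3) 𝓘(ℝ, ℝ) φ x) {G : ℝ → ℝ}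
    (hG0 : ∀ s, |s| ≤ δ → G s = 0) (hG1 : ∀ s, 2 * δ ≤ |s| → G s = s)
    (hGd : ∀ s, ∃ g', HasDerivAt G g' s ∧ |g'| ≤ C) :
    dirichletEnergy h (G ∘ φ) ≤ dirichletEnergy h φ +
      ENNReal.ofReal (C ^ 2) * ∫⁻ x in (fun x ↦ |φ x|) ⁻¹' Ioc 0 (2 * δ),
        ENNReal.ofReal (gradNorm h φ x ^ 2) ∂(riemannianMeasure h) := by
  have hT : MeasurableSet ((fun x ↦ |φ x|) ⁻¹' Ioc 0 (2 * δ)) :=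
    (continuous_abs.comp hφc).measurable measurableSet_Ioc
  -- where `|φ| < δ`, `G ∘ φ` is locally zero
  have hsmall : ∀ x, |φ x| < δ → gradNorm h (G ∘ φ) x = 0 := fun x hx ↦
    gradNorm_eq_zero_of_eventuallyEq_const h (c := 0) (Filter.eventuallyEq_of_mem
      ((isOpen_lt (continuous_abs.comp hφc) continuous_const).mem_nhds hx)
      fun y hy ↦ hG0 _ (le_of_lt hy))
  -- on the collar, `|∇(G ∘ φ)|² ≤ C² |∇φ|²`
  have hcollar : ∀ x ∈ (fun x ↦ |φ x|) ⁻¹' Ioc 0 (2 * δ),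
      ENNReal.ofReal (gradNorm h (G ∘ φ) x ^ 2) ≤
        ENNReal.ofReal (C ^ 2) * ENNReal.ofReal (gradNorm h φ x ^ 2) := fun x hx ↦ by
    obtain ⟨g', hg', hg'C⟩ := hGd (φ x)
    rw [gradNorm_real_comp h hg' (hφd x hx.1 hx.2), mul_pow, ← ENNReal.ofReal_mul (sq_nonneg _)]
    exact ENNReal.ofReal_le_ofReal (mul_le_mul_of_nonneg_right
      (pow_le_pow_left₀ (abs_nonneg _) hg'C 2) (sq_nonneg _))
  -- off the collar, `|∇(G ∘ φ)|² ≤ |∇φ|²`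
  have hoff : ∀ x ∈ ((fun x ↦ |φ x|) ⁻¹' Ioc 0 (2 * δ))ᶜ,
      ENNReal.ofReal (gradNorm h (G ∘ φ) x ^ 2) ≤ ENNReal.ofReal (gradNorm h φ x ^ 2) := by
    intro x hx
    simp only [mem_compl_iff, mem_preimage, mem_Ioc, not_and, not_le] at hx
    by_cases hx0 : φ x = 0
    · rw [hsmall x (by simpa [hx0] using hδ)]
      simp
    · have h2 : 2 * δ < |φ x| := hx (abs_pos.2 hx0)
      have hev : (G ∘ φ) =ᶠ[𝓝 x] φ := Filter.eventuallyEq_of_mem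
        ((isOpen_lt continuous_const (continuous_abs.comp hφc)).mem_nhds h2)
        fun y hy ↦ hG1 _ (le_of_lt hy)
      rw [gradNorm_congr_of_eventuallyEq h hev]
  -- split the energy along the collar
  calc dirichletEnergy h (G ∘ φ)
      = (∫⁻ x in (fun x ↦ |φ x|) ⁻¹' Ioc 0 (2 * δ), ENNReal.ofReal (gradNorm h (G ∘ φ) x ^ 2)
            ∂(riemannianMeasure h)) +
          ∫⁻ x in ((fun x ↦ |φ x|) ⁻¹' Ioc 0 (2 * δ))ᶜ, ENNReal.ofReal (gradNorm h (G ∘ φ) x ^ 2)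
            ∂(riemannianMeasure h) := by
        rw [dirichletEnergy, ← lintegral_add_measure, Measure.restrict_add_restrict_compl hT]
    _ ≤ (∫⁻ x in (fun x ↦ |φ x|) ⁻¹' Ioc 0 (2 * δ),
            ENNReal.ofReal (C ^ 2) * ENNReal.ofReal (gradNorm h φ x ^ 2) ∂(riemannianMeasure h)) +
          ∫⁻ x in ((fun x ↦ |φ x|) ⁻¹' Ioc 0 (2 * δ))ᶜ, ENNReal.ofReal (gradNorm h φ x ^ 2)
            ∂(riemannianMeasure h) :=
        add_le_add (setLIntegral_mono' hT hcollar) (setLIntegral_mono' hT.compl hoff)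
    _ ≤ ENNReal.ofReal (C ^ 2) * (∫⁻ x in (fun x ↦ |φ x|) ⁻¹' Ioc 0 (2 * δ),
            ENNReal.ofReal (gradNorm h φ x ^ 2) ∂(riemannianMeasure h)) + dirichletEnergy h φ := by
        rw [lintegral_const_mul' _ _ ENNReal.ofReal_ne_top]
        exact add_le_add le_rfl (setLIntegral_le_lintegral _ _)
    _ = _ := add_comm _ _

/-- **Energy of a truncation at level `1`.** For `φ` continuous and differentiable on the collar
`{0 < |1 - φ| ≤ 2δ}`, and `G` a truncation at level `0` as above, the function
`x ↦ 1 - G(1 - φ x)` (equal to `1` where `|1 - φ| ≤ δ`, to `φ` where `|1 - φ| ≥ 2δ`) has energy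
at most `∫ |∇φ|² + C² ∫_{0 < |1 - φ| ≤ 2δ} |∇φ|²` (the previous estimate for `1 - φ`, the slope
being invariant under `u ↦ 1 - u`). [folklore] -/
theorem dirichletEnergy_levelOne_trunc_le {φ : X → ℝ} (hφc : Continuous φ) {δ C : ℝ} (hδ : 0 < δ)
    (hφd : ∀ x, 0 < |1 - φ x| → |1 - φ x| ≤ 2 * δ → MDifferentiableAt (𝓡 3) 𝓘(ℝ, ℝ) φ x)
    {G : ℝ → ℝ} (hG0 : ∀ s, |s| ≤ δ → G s = 0) (hG1 : ∀ s, 2 * δ ≤ |s| → G s = s)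
    (hGd : ∀ s, ∃ g', HasDerivAt G g' s ∧ |g'| ≤ C) :
    dirichletEnergy h (fun x ↦ 1 - G (1 - φ x)) ≤ dirichletEnergy h φ +
      ENNReal.ofReal (C ^ 2) * ∫⁻ x in (fun x ↦ |1 - φ x|) ⁻¹' Ioc 0 (2 * δ),
        ENNReal.ofReal (gradNorm h φ x ^ 2) ∂(riemannianMeasure h) := by
  have hψc : Continuous fun x ↦ 1 - φ x := continuous_const.sub hφc
  have hψd : ∀ x, 0 < |1 - φ x| → |1 - φ x| ≤ 2 * δ →
      MDifferentiableAt (𝓡 3) 𝓘(ℝ, ℝ) (fun x ↦ 1 - φ x) x := fun x h1 h2 ↦ by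
    have h1' : HasDerivAt (fun s : ℝ ↦ 1 - s) (-1) (φ x) := by
      simpa using (hasDerivAt_id (φ x)).const_sub 1
    exact (hasMFDerivAt_real_comp (G := fun s ↦ 1 - s) h1' (hφd x h1 h2)).mdifferentiableAt
  have key := dirichletEnergy_real_comp_le_of_mdifferentiableAt h hψc hδ hψd hG0 hG1 hGd
  -- `E(1 - G ∘ (1 - φ)) = E(G ∘ (1 - φ))`, `E(1 - φ) = E(φ)`, `|∇(1 - φ)| = |∇φ|`
  have hE : dirichletEnergy h (fun x ↦ 1 - G (1 - φ x)) =
      dirichletEnergy h (G ∘ fun x ↦ 1 - φ x) :=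
    dirichletEnergy_const_sub h (G ∘ fun x ↦ 1 - φ x) 1
  rw [hE]
  simp only [dirichletEnergy_const_sub, gradNorm_const_sub] at key
  exact key

/-! ### The capacity over smooth functions supported in `U` -/

omit [IsManifold (𝓡 3) ∞ X] [T2Space X] [LocallyCompactSpace X] [MeasurableSpace X]
  [BorelSpace X] in
/-- A function equal to `1` on a far region of the end tends to `1` at infinity in the end.
[folklore] -/
theorem tendstoAtEnd_of_eqOn_far {φ : X → ℝ} {R : ℝ} (hφ : ∀ x ∈ e.far R, φ x = 1) :
    TendstoAtEnd e φ 1 := by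
  refine tendsto_const_nhds.congr' ?_
  filter_upwards [eventually_cobounded_le_norm (E := E3) (max R e.R + 1)] with z hz
  have hzR : e.R < ‖z‖ := by linarith [le_max_right R e.R]
  rw [endValue_of_lt e _ hzR]
  refine (hφ _ (e.mem_far_iff.2 ⟨⟨z, mem_exteriorRegion.2 hzR⟩, ?_, rfl⟩)).symm
  show R < ‖z‖
  linarith [le_max_left R e.R]

omit [IsManifold (𝓡 3) ∞ X] [T2Space X] [LocallyCompactSpace X] [MeasurableSpace X]
  [BorelSpace X] in
/-- From `φ → 1` at infinity in the end: for every `δ > 0` there is a radius `R ≥ e.R` beyond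
which `|1 - φ| < δ`. [folklore] -/
theorem TendstoAtEnd.exists_radius_abs_sub_lt {φ : X → ℝ} (hφ : TendstoAtEnd e φ 1) {δ : ℝ}
    (hδ : 0 < δ) : ∃ R, e.R ≤ R ∧ ∀ x ∈ e.far R, |1 - φ x| < δ := by
  have hev : ∀ᶠ z in Bornology.cobounded E3, dist (endValue e φ z) 1 < δ :=
    Metric.tendsto_nhds.1 hφ δ hδ
  obtain ⟨R₀, -, hR₀⟩ := (Filter.hasBasis_cobounded_norm (E := E3)).eventually_iff.1 hev
  refine ⟨max R₀ e.R, le_max_right _ _, fun x hx ↦ ?_⟩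
  obtain ⟨z, hz, rfl⟩ := e.mem_far_iff.1 hx
  have hzR : e.R < ‖(z : E3)‖ := mem_exteriorRegion.1 z.2
  have h1 := hR₀ (show (z : E3) ∈ {x : E3 | R₀ ≤ ‖x‖} by
    simp only [mem_setOf_eq]; linarith [le_max_left R₀ e.R, hz.le])
  rw [endValue_of_lt e _ hzR, Real.dist_eq] at h1
  rwa [abs_sub_comm]

/-- **The capacity over smooth functions supported in the open outside region.** The capacity
`ℰ(Σ, g)` (the infimum of `(1/2π) ∫ |∇φ|²` over `IsCapacityTestFn e U`) equals the infimum over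
the subclass of globally smooth `φ` with `tsupport φ ⊆ U` — i.e. vanishing on a *neighbourhood*
of `Σ` and of the inside — tending to `1` at infinity. Proof: the truncations `G_δ ∘ φ` of
`horizonCapacity_eq_iInf_contMDiff` vanish on the open neighbourhood `{|φ| < δ}` of `X ∖ U`, so
their supports `⊆ {δ ≤ |φ|}` lie in `U`; their energies tend to that of `φ` as `δ → 0`.
Bray 2001, §6 Def. 17. [cite: BrayRPI2001, §6 Def. 17] -/
theorem horizonCapacity_eq_iInf_tsupport_subset (e : AFEnd X) (U : Opens X) :
    horizonCapacity h e U = ⨅ (φ : X → ℝ) (_ : ContMDiff (𝓡 3) 𝓘(ℝ, ℝ) ∞ φ ∧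
      tsupport φ ⊆ (U : Set X) ∧ TendstoAtEnd e φ 1),
      ENNReal.ofReal (2 * π)⁻¹ * dirichletEnergy h φ := by
  refine le_antisymm (le_iInf₂ fun φ hφ ↦ horizonCapacity_le h e U
    (IsCapacityTestFn.of_contMDiff hφ.1
      (fun x hx ↦ image_eq_zero_of_notMem_tsupport fun hx' ↦ hx (hφ.2.1 hx')) hφ.2.2)) ?_
  refine le_iInf₂ fun φ hφ ↦ ?_
  -- infinite energy: nothing to prove
  by_cases hE : dirichletEnergy h φ = ⊤
  · rw [hE, ENNReal.mul_top (ENNReal.ofReal_pos.2 (by positivity)).ne']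
    exact le_top
  -- the truncations `G n` at scale `δ n = 1 / (2 (n + 1))`
  obtain ⟨C, hC1, hG⟩ := exists_smooth_truncation
  set δ : ℕ → ℝ := fun n ↦ 1 / (2 * (n + 1)) with hδ_def
  have hδ : ∀ n, 0 < δ n := fun n ↦ by positivity
  have hδ1 : ∀ n, 2 * δ n ≤ 1 := fun n ↦ by
    have hn : (1 : ℝ) ≤ n + 1 := by linarith [n.cast_nonneg (α := ℝ)]
    rw [hδ_def, mul_one_div, div_le_one (by positivity)]
    linarith
  choose G hGs hG0 hG1 hGd using fun n ↦ hG (δ n) (hδ n)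
  -- the collar integrals tend to zero
  have hT : ∀ n, MeasurableSet ((fun x ↦ |φ x|) ⁻¹' Ioc 0 (2 * δ n)) := fun n ↦
    (continuous_abs.comp hφ.continuous).measurable measurableSet_Ioc
  have hlim : Tendsto (fun n ↦ ∫⁻ x in (fun x ↦ |φ x|) ⁻¹' Ioc 0 (2 * δ n),
      ENNReal.ofReal (gradNorm h φ x ^ 2) ∂(riemannianMeasure h)) atTop (𝓝 0) := by
    have hanti : Antitone fun n ↦ (fun x ↦ |φ x|) ⁻¹' Ioc 0 (2 * δ n) := by
      intro n m hnm
      refine preimage_mono (Ioc_subset_Ioc_right ?_)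
      have : (n : ℝ) ≤ m := Nat.cast_le.2 hnm
      simp only [hδ_def]
      gcongr
    have hinter : ⋂ n, (fun x ↦ |φ x|) ⁻¹' Ioc 0 (2 * δ n) = ∅ := by
      refine Set.subset_empty_iff.1 fun x hx ↦ ?_
      rw [mem_iInter] at hx
      obtain ⟨n, hn⟩ := exists_nat_one_div_lt (hx 0).1
      have h2 : |φ x| ≤ 2 * δ n := (hx n).2
      have h3 : 2 * δ n = 1 / (n + 1) := by
        rw [hδ_def]
        field_simp
      linarith
    have hfin : (riemannianMeasure h).withDensity (fun x ↦ ENNReal.ofReal (gradNorm h φ x ^ 2))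
        ((fun x ↦ |φ x|) ⁻¹' Ioc 0 (2 * δ 0)) ≠ ⊤ := by
      refine ne_top_of_le_ne_top hE ?_
      rw [withDensity_apply _ (hT 0)]
      exact setLIntegral_le_lintegral _ _
    have hμ := tendsto_measure_iInter_atTop
      (μ := (riemannianMeasure h).withDensity fun x ↦ ENNReal.ofReal (gradNorm h φ x ^ 2))
      (fun n ↦ (hT n).nullMeasurableSet) hanti ⟨0, hfin⟩
    rw [hinter, measure_empty] at hμ
    refine hμ.congr fun n ↦ ?_
    simp only [Function.comp_apply, withDensity_apply _ (hT n)]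
  -- the truncations are supported in `U`
  have hsupp : ∀ n, tsupport (G n ∘ φ) ⊆ (U : Set X) := fun n ↦ by
    -- `support ⊆ {δ n ≤ |φ|}`, a closed subset of `U`
    have h1 : tsupport (G n ∘ φ) ⊆ {x | δ n ≤ |φ x|} := by
      refine closure_minimal (fun x hx ↦ ?_)
        (isClosed_le continuous_const (continuous_abs.comp hφ.continuous))
      by_contra hlt
      exact hx (hG0 n _ (le_of_lt (not_le.1 hlt)))
    refine h1.trans fun x hx ↦ ?_
    by_contra hxU
    have h0 : φ x = 0 := hφ.2.2.1 x hxU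
    have h2 : δ n ≤ |φ x| := hx
    rw [h0, abs_zero] at h2
    exact absurd h2 (not_le.2 (hδ n))
  -- the bound through the `n`-th truncation
  have hbound : ∀ n, (⨅ (ψ : X → ℝ) (_ : ContMDiff (𝓡 3) 𝓘(ℝ, ℝ) ∞ ψ ∧
      tsupport ψ ⊆ (U : Set X) ∧ TendstoAtEnd e ψ 1),
      ENNReal.ofReal (2 * π)⁻¹ * dirichletEnergy h ψ) ≤
      ENNReal.ofReal (2 * π)⁻¹ * (dirichletEnergy h φ + ENNReal.ofReal (C ^ 2) *
        ∫⁻ x in (fun x ↦ |φ x|) ⁻¹' Ioc 0 (2 * δ n), ENNReal.ofReal (gradNorm h φ x ^ 2)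
          ∂(riemannianMeasure h)) := fun n ↦ by
    have h1 : TendstoAtEnd e (G n ∘ φ) 1 := by
      have h1' := hφ.tendstoAtEnd.real_comp (hGs n).continuous.continuousAt
      rwa [hG1 n 1 (by simpa using hδ1 n)] at h1'
    exact (iInf₂_le (G n ∘ φ) ⟨hφ.contMDiff_real_comp (hδ n) (hGs n) (hG0 n), hsupp n, h1⟩).trans
      (mul_le_mul_right (hφ.dirichletEnergy_real_comp_le h (hδ n) (hG0 n) (hG1 n) (hGd n)) _)
  -- pass to the limit
  have hl := ENNReal.Tendsto.const_mul (tendsto_const_nhds.add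
    (ENNReal.Tendsto.const_mul hlim (Or.inr ENNReal.ofReal_ne_top))) (Or.inr ENNReal.ofReal_ne_top)
    (a := ENNReal.ofReal (2 * π)⁻¹) (b := dirichletEnergy h φ + ENNReal.ofReal (C ^ 2) * 0)
  rw [mul_zero, add_zero] at hl
  exact ge_of_tendsto' hl hbound

/-- **The capacity over smooth functions supported in `U` and equal to `1` far out.** The
capacity `ℰ(Σ, g)` equals the infimum of `(1/2π) ∫ |∇φ|²` over globally smooth `φ` with
`tsupport φ ⊆ U` that are *identically `1` on a far region* `e.far R` (`R ≥ e.R`) of the end.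
Differences of two such functions are smooth and compactly supported in `U` when `U` is an
exterior region, which is the form in which Green's identity applies. Proof: truncate a function
`φ` of `horizonCapacity_eq_iInf_tsupport_subset` at level `1`, `ψ_δ = 1 - G_δ ∘ (1 - φ)`: it is
`1` where `|1 - φ| < δ`, which contains a far region (`φ → 1`), still has `tsupport ψ_δ ⊆
tsupport φ` (`G_δ(1) = 1`), and `∫ |∇ψ_δ|² ≤ ∫ |∇φ|² + C² ∫_{0 < |1 - φ| ≤ 2δ} |∇φ|² → ∫ |∇φ|²`
(`dirichletEnergy_levelOne_trunc_le`, continuity from above along the shrinking collars).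
Bray 2001, §6 Def. 17. [cite: BrayRPI2001, §6 Def. 17] -/
theorem horizonCapacity_eq_iInf_eqOn_far (e : AFEnd X) (U : Opens X) :
    horizonCapacity h e U = ⨅ (φ : X → ℝ) (_ : ContMDiff (𝓡 3) 𝓘(ℝ, ℝ) ∞ φ ∧
      tsupport φ ⊆ (U : Set X) ∧ ∃ R, e.R ≤ R ∧ ∀ x ∈ e.far R, φ x = 1),
      ENNReal.ofReal (2 * π)⁻¹ * dirichletEnergy h φ := by
  rw [horizonCapacity_eq_iInf_tsupport_subset h e U]
  refine le_antisymm (le_iInf₂ fun φ hφ ↦ ?_) (le_iInf₂ fun φ hφ ↦ ?_)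
  · obtain ⟨R, -, hR⟩ := hφ.2.2
    exact iInf₂_le φ ⟨hφ.1, hφ.2.1, tendstoAtEnd_of_eqOn_far hR⟩
  -- infinite energy: nothing to prove
  by_cases hE : dirichletEnergy h φ = ⊤
  · rw [hE, ENNReal.mul_top (ENNReal.ofReal_pos.2 (by positivity)).ne']
    exact le_top
  have hφc : Continuous φ := hφ.1.continuous
  have hφd : ∀ x, MDifferentiableAt (𝓡 3) 𝓘(ℝ, ℝ) φ x := fun x ↦
    (hφ.1 x).mdifferentiableAt (by simp)
  -- the truncations `G n` at scale `δ n = 1 / (4 (n + 1))`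
  obtain ⟨C, hC1, hG⟩ := exists_smooth_truncation
  set δ : ℕ → ℝ := fun n ↦ 1 / (4 * (n + 1)) with hδ_def
  have hδ : ∀ n, 0 < δ n := fun n ↦ by positivity
  have hδ1 : ∀ n, 2 * δ n ≤ 1 := fun n ↦ by
    have hn : (1 : ℝ) ≤ n + 1 := by linarith [n.cast_nonneg (α := ℝ)]
    rw [hδ_def, mul_one_div, div_le_one (by positivity)]
    linarith
  choose G hGs hG0 hG1 hGd using fun n ↦ hG (δ n) (hδ n)
  -- the level-one truncations
  set ψ : ℕ → X → ℝ := fun n x ↦ 1 - G n (1 - φ x) with hψ_def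
  have hψs : ∀ n, ContMDiff (𝓡 3) 𝓘(ℝ, ℝ) ∞ (ψ n) := fun n ↦
    (contDiff_const.sub ((hGs n).comp (contDiff_const.sub contDiff_id))).comp_contMDiff hφ.1
  have hψsupp : ∀ n, tsupport (ψ n) ⊆ (U : Set X) := fun n ↦ by
    refine (closure_mono fun x hx ↦ ?_).trans hφ.2.1
    -- `support (ψ n) ⊆ support φ` since `G n 1 = 1`
    intro hx0
    refine hx ?_
    simp only [hψ_def, hx0, sub_zero, hG1 n 1 (by simpa using hδ1 n), sub_self]
  have hψfar : ∀ n, ∃ R, e.R ≤ R ∧ ∀ x ∈ e.far R, ψ n x = 1 := fun n ↦ by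
    obtain ⟨R, hR, hfar⟩ := TendstoAtEnd.exists_radius_abs_sub_lt hφ.2.2 (hδ n)
    refine ⟨R, hR, fun x hx ↦ ?_⟩
    simp only [hψ_def, hG0 n _ (le_of_lt (hfar x hx)), sub_zero]
  -- the collar integrals tend to zero
  have hT : ∀ n, MeasurableSet ((fun x ↦ |1 - φ x|) ⁻¹' Ioc 0 (2 * δ n)) := fun n ↦
    (continuous_abs.comp (continuous_const.sub hφc)).measurable measurableSet_Ioc
  have hlim : Tendsto (fun n ↦ ∫⁻ x in (fun x ↦ |1 - φ x|) ⁻¹' Ioc 0 (2 * δ n),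
      ENNReal.ofReal (gradNorm h φ x ^ 2) ∂(riemannianMeasure h)) atTop (𝓝 0) := by
    have hanti : Antitone fun n ↦ (fun x ↦ |1 - φ x|) ⁻¹' Ioc 0 (2 * δ n) := by
      intro n m hnm
      refine preimage_mono (Ioc_subset_Ioc_right ?_)
      have : (n : ℝ) ≤ m := Nat.cast_le.2 hnm
      simp only [hδ_def]
      gcongr
    have hinter : ⋂ n, (fun x ↦ |1 - φ x|) ⁻¹' Ioc 0 (2 * δ n) = ∅ := by
      refine Set.subset_empty_iff.1 fun x hx ↦ ?_
      rw [mem_iInter] at hx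
      obtain ⟨n, hn⟩ := exists_nat_one_div_lt (hx 0).1
      have h2 : |1 - φ x| ≤ 2 * δ n := (hx n).2
      have h3 : 2 * δ n ≤ 1 / (n + 1) := by
        have hn1 : (0 : ℝ) < n + 1 := by positivity
        have h4 : 2 * δ n = (1 / 2) * (1 / (n + 1)) := by
          rw [hδ_def]
          field_simp
          ring
        rw [h4]
        have h5 : 0 ≤ 1 / ((n : ℝ) + 1) := by positivity
        nlinarith
      linarith
    have hfin : (riemannianMeasure h).withDensity (fun x ↦ ENNReal.ofReal (gradNorm h φ x ^ 2))
        ((fun x ↦ |1 - φ x|) ⁻¹' Ioc 0 (2 * δ 0)) ≠ ⊤ := by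
      refine ne_top_of_le_ne_top hE ?_
      rw [withDensity_apply _ (hT 0)]
      exact setLIntegral_le_lintegral _ _
    have hμ := tendsto_measure_iInter_atTop
      (μ := (riemannianMeasure h).withDensity fun x ↦ ENNReal.ofReal (gradNorm h φ x ^ 2))
      (fun n ↦ (hT n).nullMeasurableSet) hanti ⟨0, hfin⟩
    rw [hinter, measure_empty] at hμ
    refine hμ.congr fun n ↦ ?_
    simp only [Function.comp_apply, withDensity_apply _ (hT n)]
  -- the bound through the `n`-th truncation
  have hbound : ∀ n, (⨅ (ψ : X → ℝ) (_ : ContMDiff (𝓡 3) 𝓘(ℝ, ℝ) ∞ ψ ∧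
      tsupport ψ ⊆ (U : Set X) ∧ ∃ R, e.R ≤ R ∧ ∀ x ∈ e.far R, ψ x = 1),
      ENNReal.ofReal (2 * π)⁻¹ * dirichletEnergy h ψ) ≤
      ENNReal.ofReal (2 * π)⁻¹ * (dirichletEnergy h φ + ENNReal.ofReal (C ^ 2) *
        ∫⁻ x in (fun x ↦ |1 - φ x|) ⁻¹' Ioc 0 (2 * δ n), ENNReal.ofReal (gradNorm h φ x ^ 2)
          ∂(riemannianMeasure h)) := fun n ↦
    (iInf₂_le (ψ n) ⟨hψs n, hψsupp n, hψfar n⟩).trans (mul_le_mul_right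
      (dirichletEnergy_levelOne_trunc_le h hφc (hδ n) (fun x _ _ ↦ hφd x) (hG0 n) (hG1 n)
        (hGd n)) _)
  -- pass to the limit
  have hl := ENNReal.Tendsto.const_mul (tendsto_const_nhds.add
    (ENNReal.Tendsto.const_mul hlim (Or.inr ENNReal.ofReal_ne_top))) (Or.inr ENNReal.ofReal_ne_top)
    (a := ENNReal.ofReal (2 * π)⁻¹) (b := dirichletEnergy h φ + ENNReal.ofReal (C ^ 2) * 0)
  rw [mul_zero, add_zero] at hl
  exact ge_of_tendsto' hl hbound

end TestClasses

/-! ### A dominated convergence lemma -/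

section DCT

/-- **Dominated convergence for bounded multipliers tending to `1`.** If `g` is integrable on
`U`, the `a n` are uniformly bounded, each `a n · g` is a.e. strongly measurable on `U`, and
`a n x = 1` eventually for each `x ∈ U`, then `∫_U a n · g → ∫_U g`. [folklore] -/
theorem tendsto_setIntegral_mul_of_eventually_eq_one {α : Type*} [MeasurableSpace α]
    {μ : Measure α} {V : Set α}
    (hV : MeasurableSet V) {g : α → ℝ} (hg : Integrable g (μ.restrict V)) {a : ℕ → α → ℝ}
    (ha : ∀ n, AEStronglyMeasurable (fun x ↦ a n x * g x) (μ.restrict V)) {C : ℝ}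
    (hC : ∀ n x, |a n x| ≤ C) (hlim : ∀ x ∈ V, ∀ᶠ n in atTop, a n x = 1) :
    Tendsto (fun n ↦ ∫ x in V, a n x * g x ∂μ) atTop (𝓝 (∫ x in V, g x ∂μ)) := by
  refine tendsto_integral_of_dominated_convergence (fun x ↦ C * ‖g x‖) ha (hg.norm.const_mul C)
    (fun n ↦ Eventually.of_forall fun x ↦ ?_) ?_
  · rw [norm_mul, Real.norm_eq_abs]
    exact mul_le_mul_of_nonneg_right (hC n x) (norm_nonneg _)
  · filter_upwards [ae_restrict_mem hV] with x hx
    refine tendsto_const_nhds.congr' ?_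
    filter_upwards [hlim x hx] with n hn
    rw [hn, one_mul]

end DCT

/-! ## The harmonic potential attains the capacity -/

section Harmonic

variable {X : Type} [TopologicalSpace X] [ChartedSpace E3 X] [IsManifold (𝓡 3) ∞ X]
  {e : AFEnd X} {U : Opens X}

omit [IsManifold (𝓡 3) ∞ X] in
/-- **Exterior regions are compact modulo every far region**: if `U` is an exterior region of
the end `e`, then `closure U ∖ e.far R` is compact for every radius `R` (by definition this
holds for one radius `R' > e.R`; the difference is covered in addition by the compact chart shell
`Φ({R' ≤ ‖z‖ ≤ R})`). [folklore] -/
theorem IsExteriorRegion.isCompact_closure_diff_far (hU : IsExteriorRegion e U) (R : ℝ) :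
    IsCompact (closure (U : Set X) \ e.far R) := by
  obtain ⟨-, R', hR', -, hK⟩ := hU
  -- the compact chart shell `Φ({R' ≤ ‖z‖ ≤ R})`
  set K₀ : Set E3 := {y | R' ≤ ‖y‖ ∧ ‖y‖ ≤ R} with hK₀_def
  have hK₀ : IsCompact K₀ := by
    refine Metric.isCompact_of_isClosed_isBounded
      (isClosed_le continuous_const continuous_norm |>.inter
        (isClosed_le continuous_norm continuous_const)) ?_
    refine (Metric.isBounded_closedBall (x := (0 : E3)) (r := R)).subset fun y hy ↦ ?_
    rw [mem_closedBall_zero_iff]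
    exact hy.2
  set S : Set X := e.dataChart '' ((Subtype.val : exteriorRegion e.R → E3) ⁻¹' K₀) with hS_def
  have hKsub : K₀ ⊆ range (Subtype.val : exteriorRegion e.R → E3) := fun y hy ↦ by
    rw [Subtype.range_coe_subtype]
    exact mem_exteriorRegion.2 (hR'.trans_le hy.1)
  have hSc : IsCompact S := by
    refine IsCompact.image ?_ e.contMDiff_dataChart.continuous
    rw [Topology.IsEmbedding.subtypeVal.isCompact_iff, image_preimage_eq_inter_range,
      inter_eq_left.2 hKsub]
    exact hK₀
  -- `closure U ∖ far R ⊆ (closure U ∖ far R') ∪ S`, a closed subset of a compact set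
  refine (hK.union hSc).of_isClosed_subset (isClosed_closure.sdiff (e.isOpen_far R)) ?_
  rintro x ⟨hxU, hxR⟩
  by_cases hx' : x ∈ e.far R'
  · right
    obtain ⟨z, hz, rfl⟩ := e.mem_far_iff.1 hx'
    refine ⟨z, ⟨hz.le, not_lt.1 fun hlt ↦ hxR ?_⟩, rfl⟩
    exact e.mem_far_iff.2 ⟨z, hlt, rfl⟩
  · left
    exact ⟨hxU, hx'⟩

omit [IsManifold (𝓡 3) ∞ X] in
/-- The differential of a function equal to `1` on a far region vanishes there. [folklore] -/
theorem mvfderiv_eq_zero_of_eqOn_far {φ : X → ℝ} {R : ℝ} (hφR : ∀ x ∈ e.far R, φ x = 1)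
    {x : X} (hx : x ∈ e.far R) : mvfderiv (𝓡 3) φ x = 0 := by
  have hev : φ =ᶠ[𝓝 x] fun _ ↦ (1 : ℝ) :=
    Filter.eventuallyEq_of_mem ((e.isOpen_far R).mem_nhds hx) hφR
  rw [mvfderiv_congr_of_eventuallyEq hev]
  exact mvfderiv_const (I := 𝓡 3) (1 : ℝ)

omit [IsManifold (𝓡 3) ∞ X] in
/-- For a function supported in `U` and equal to `1` on `e.far R`, the differential is supported
in the set `tsupport φ ∖ e.far R`. [folklore] -/
theorem mem_of_mvfderiv_ne_zero {φ : X → ℝ} {R : ℝ} (hφR : ∀ x ∈ e.far R, φ x = 1) {x : X}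
    (hx : mvfderiv (𝓡 3) φ x ≠ 0) : x ∈ tsupport φ \ e.far R :=
  ⟨by_contra fun h ↦ hx (mvfderiv_eq_zero_of_notMem_tsupport h),
    fun h ↦ hx (mvfderiv_eq_zero_of_eqOn_far hφR h)⟩

omit [IsManifold (𝓡 3) ∞ X] in
/-- `tsupport φ ∖ e.far R` is a compact subset of `U` when `tsupport φ ⊆ U` and `U` is an
exterior region. [folklore] -/
theorem IsExteriorRegion.isCompact_tsupport_diff_far (hU : IsExteriorRegion e U) {φ : X → ℝ}
    (hφU : tsupport φ ⊆ (U : Set X)) (R : ℝ) :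
    IsCompact (tsupport φ \ e.far R) :=
  (hU.isCompact_closure_diff_far R).of_isClosed_subset
    ((isClosed_tsupport φ).sdiff (e.isOpen_far R))
    fun _ hx ↦ ⟨(hφU.trans subset_closure) hx.1, hx.2⟩

/-! ### Smooth double truncations -/

/-- **Smooth double truncations.** There is `C ≥ 0` such that for every `0 < δ ≤ 1/8` there is a
smooth `W : ℝ → ℝ` with `W = 0` on `[-δ, δ]`, `W = 1` on `[1 - δ, 1 + δ]`, `W' = 1` wherever
`|s| > 2δ` and `|1 - s| > 2δ` (there `W(s) = s` locally), and `|W'| ≤ C` everywhere: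
`W = 1 - G_δ ∘ (1 - G_δ)` for the truncations `G_δ` of `exists_smooth_truncation`. [folklore] -/
theorem exists_smooth_doubleTruncation :
    ∃ C : ℝ, 0 ≤ C ∧ ∀ δ : ℝ, 0 < δ → δ ≤ 1 / 8 → ∃ W : ℝ → ℝ, ContDiff ℝ ∞ W ∧
      (∀ s, |s| ≤ δ → W s = 0) ∧ (∀ s, |1 - s| ≤ δ → W s = 1) ∧
      (∀ s, 2 * δ < |s| → 2 * δ < |1 - s| → deriv W s = 1) ∧ ∀ s, |deriv W s| ≤ C := by
  obtain ⟨C₀, hC₀, hG⟩ := exists_smooth_truncation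
  refine ⟨C₀ * C₀, by positivity, fun δ hδ hδ8 ↦ ?_⟩
  obtain ⟨G, hGs, hG0, hG1, hGd⟩ := hG δ hδ
  have hG_one : G 1 = 1 := hG1 1 (by rw [abs_one]; linarith)
  refine ⟨fun s ↦ 1 - G (1 - G s), contDiff_const.sub (hGs.comp (contDiff_const.sub hGs)),
    fun s hs ↦ ?_, fun s hs ↦ ?_, fun s hs hs1 ↦ ?_, fun s ↦ ?_⟩
  · simp only [hG0 s hs, sub_zero, hG_one, sub_self]
  · have hs' : 2 * δ ≤ |s| := by
      have : 1 - δ ≤ s := by linarith [(abs_le.1 hs).2]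
      rw [abs_of_pos (by linarith)]
      linarith
    simp only [hG1 s hs', hG0 (1 - s) hs, sub_zero]
  · -- `W = id` near `s`
    have hO : IsOpen ({t : ℝ | 2 * δ < |t|} ∩ {t | 2 * δ < |1 - t|}) :=
      (isOpen_lt continuous_const continuous_abs).inter
        (isOpen_lt continuous_const (continuous_abs.comp (continuous_const.sub continuous_id)))
    have hev : (fun t ↦ 1 - G (1 - G t)) =ᶠ[𝓝 s] id := by
      filter_upwards [hO.mem_nhds ⟨hs, hs1⟩] with t ht
      simp only [hG1 t ht.1.le, hG1 (1 - t) ht.2.le, sub_sub_cancel, id]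
    rw [hev.deriv_eq, deriv_id]
  · obtain ⟨g₁, hg₁, hg₁C⟩ := hGd s
    obtain ⟨g₂, hg₂, hg₂C⟩ := hGd (1 - G s)
    have hW : HasDerivAt (fun t ↦ 1 - G (1 - G t)) (g₂ * g₁) s := by
      have h1 : HasDerivAt (fun t ↦ 1 - G t) (-g₁) s := hg₁.const_sub 1
      have h2 : HasDerivAt (fun t ↦ G (1 - G t)) (g₂ * -g₁) s := hg₂.comp s h1
      simpa using h2.const_sub (1 : ℝ)
    rw [hW.deriv, abs_mul]
    exact mul_le_mul hg₂C hg₁C (abs_nonneg _) (le_trans (by norm_num) hC₀)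

/-! ### Differentials: chain rule and bilinear algebra of `h⁻¹` -/

omit [IsManifold (𝓡 3) ∞ X] in
/-- Chain rule for `mvfderiv`: `d(G ∘ φ)_x = G'(φ x) · dφ_x`. [folklore] -/
theorem mvfderiv_real_comp_smul {G : ℝ → ℝ} {g' : ℝ} {φ : X → ℝ} {x : X}
    (hG : HasDerivAt G g' (φ x)) (hφ : MDifferentiableAt (𝓡 3) 𝓘(ℝ, ℝ) φ x) :
    mvfderiv (𝓡 3) (G ∘ φ) x = g' • mvfderiv (𝓡 3) φ x := by
  ext v
  change (mfderiv (𝓡 3) 𝓘(ℝ, ℝ) (G ∘ φ) x) v = g' • (mfderiv (𝓡 3) 𝓘(ℝ, ℝ) φ x) v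
  rw [mfderiv_real_comp hG hφ]
  rfl

section Algebra

variable (h : ContMDiffRiemannianMetric (𝓡 3) ∞ E3 (TangentSpace (𝓡 3) : X → Type _))

/-- `h⁻¹(α - β, γ) = h⁻¹(α, γ) - h⁻¹(β, γ)`. [folklore] -/
theorem innerDual_sub_left (x : X) (α β γ : Module.Dual ℝ (TangentSpace (𝓡 3) x)) :
    (ofRiemannian h).innerDual x (α - β) γ =
      (ofRiemannian h).innerDual x α γ - (ofRiemannian h).innerDual x β γ := by
  simp [PseudoRiemannianMetric.innerDual, LinearMap.sub_apply]

/-- `h⁻¹(c α, γ) = c h⁻¹(α, γ)`. [folklore] -/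
theorem innerDual_smul_left (x : X) (c : ℝ) (α γ : Module.Dual ℝ (TangentSpace (𝓡 3) x)) :
    (ofRiemannian h).innerDual x (c • α) γ = c * (ofRiemannian h).innerDual x α γ := by
  simp [PseudoRiemannianMetric.innerDual, LinearMap.smul_apply]

/-- The polarisation `h⁻¹(α - β, α - β) = h⁻¹(α, α) - 2 h⁻¹(α, β) + h⁻¹(β, β)`. [folklore] -/
theorem innerDual_sub_sub (x : X) (α β : Module.Dual ℝ (TangentSpace (𝓡 3) x)) :
    (ofRiemannian h).innerDual x (α - β) (α - β) = (ofRiemannian h).innerDual x α α -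
      2 * (ofRiemannian h).innerDual x α β + (ofRiemannian h).innerDual x β β := by
  rw [innerDual_sub_left, (ofRiemannian h).innerDual_comm x α (α - β),
    (ofRiemannian h).innerDual_comm x β (α - β), innerDual_sub_left, innerDual_sub_left,
    (ofRiemannian h).innerDual_comm x β α]
  ring

/-- **The energy density of `φ` around `φ₀`**: at a point where both are differentiable,
`|∇φ|² = |∇φ₀|² + 2 (h⁻¹(dφ, dφ₀) - |∇φ₀|²) + |∇(φ - φ₀)|²`. [folklore] -/
theorem gradNorm_sq_expand {φ φ₀ : X → ℝ} {x : X} (hφ : MDifferentiableAt (𝓡 3) 𝓘(ℝ, ℝ) φ x)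
    (hφ₀ : MDifferentiableAt (𝓡 3) 𝓘(ℝ, ℝ) φ₀ x) :
    gradNorm h φ x ^ 2 = gradNorm h φ₀ x ^ 2 +
      2 * ((ofRiemannian h).innerDual x (mvfderiv (𝓡 3) φ x).toLinearMap
        (mvfderiv (𝓡 3) φ₀ x).toLinearMap - gradNorm h φ₀ x ^ 2) +
      gradNorm h (fun y ↦ φ y - φ₀ y) x ^ 2 := by
  simp only [gradNorm_sq_eq_innerDual_mvfderiv]
  rw [mvfderiv_fun_sub hφ hφ₀, ContinuousLinearMap.toLinearMap_sub, innerDual_sub_sub]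
  ring

/-- The pairing of a composite: `h⁻¹(d(G ∘ φ), dφ) = G'(φ) |∇φ|²`. [folklore] -/
theorem innerDual_mvfderiv_real_comp {G : ℝ → ℝ} {g' : ℝ} {φ : X → ℝ} {x : X}
    (hG : HasDerivAt G g' (φ x)) (hφ : MDifferentiableAt (𝓡 3) 𝓘(ℝ, ℝ) φ x) :
    (ofRiemannian h).innerDual x (mvfderiv (𝓡 3) (G ∘ φ) x).toLinearMap
      (mvfderiv (𝓡 3) φ x).toLinearMap = g' * gradNorm h φ x ^ 2 := by
  rw [mvfderiv_real_comp_smul hG hφ, ContinuousLinearMap.toLinearMap_smul, innerDual_smul_left,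
    gradNorm_sq_eq_innerDual_mvfderiv]

/-- The energy density of a composite: `|∇(G ∘ φ)|² = G'(φ)² |∇φ|²`. [folklore] -/
theorem gradNorm_sq_real_comp {G : ℝ → ℝ} {g' : ℝ} {φ : X → ℝ} {x : X}
    (hG : HasDerivAt G g' (φ x)) (hφ : MDifferentiableAt (𝓡 3) 𝓘(ℝ, ℝ) φ x) :
    gradNorm h (G ∘ φ) x ^ 2 = g' ^ 2 * gradNorm h φ x ^ 2 := by
  rw [gradNorm_real_comp h hG hφ, mul_pow, sq_abs]

end Algebra

/-! ### The pairing `h⁻¹(dφ, dφ₀)` for comparison functions -/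

section Pairing

variable [T2Space X] [LocallyCompactSpace X] [SigmaCompactSpace X]
  (h : ContMDiffRiemannianMetric (𝓡 3) ∞ E3 (TangentSpace (𝓡 3) : X → Type _))

/-- **The pairing `h⁻¹(dφ, dφ₀)` of a comparison function with a function smooth on `U` is
continuous and compactly supported.** If `U` is an exterior region, `φ ∈ C¹(X)` with
`tsupport φ ⊆ U` and `φ = 1` on `e.far R`, and `φ₀ ∈ C¹(U)`, then
`x ↦ h⁻¹(dφ_x, dφ₀,ₓ)` is continuous on `X`, vanishes off the compact set `tsupport φ ∖ e.far R ⊆ U`,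
and so has compact support (globalise `φ₀` near that compact set; `dφ = 0` off it). [folklore] -/
theorem continuous_pairing_of_eqOn_far (hU : IsExteriorRegion e U) {φ φ₀ : X → ℝ}
    (hφs : ContMDiff (𝓡 3) 𝓘(ℝ, ℝ) 1 φ) (hφU : tsupport φ ⊆ (U : Set X)) {R : ℝ}
    (hφR : ∀ x ∈ e.far R, φ x = 1) (hφ₀ : ContMDiffOn (𝓡 3) 𝓘(ℝ, ℝ) 1 φ₀ U) :
    Continuous (fun x ↦ (ofRiemannian h).innerDual x (mvfderiv (𝓡 3) φ x).toLinearMap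
        (mvfderiv (𝓡 3) φ₀ x).toLinearMap) ∧
      HasCompactSupport (fun x ↦ (ofRiemannian h).innerDual x (mvfderiv (𝓡 3) φ x).toLinearMap
        (mvfderiv (𝓡 3) φ₀ x).toLinearMap) ∧
      ∀ x, x ∉ tsupport φ \ e.far R → (ofRiemannian h).innerDual x
        (mvfderiv (𝓡 3) φ x).toLinearMap (mvfderiv (𝓡 3) φ₀ x).toLinearMap = 0 := by
  have hK : IsCompact (tsupport φ \ e.far R) := hU.isCompact_tsupport_diff_far hφU R
  obtain ⟨f, hf, -, -, V, hVo, hKV, -, hfφ⟩ :=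
    exists_contMDiff_hasCompactSupport_eventuallyEq (n := 1) U.isOpen hK
      (fun x hx ↦ hφU hx.1) hφ₀
  -- off the compact set the differential of `φ` vanishes
  have hzero : ∀ x, x ∉ tsupport φ \ e.far R → mvfderiv (𝓡 3) φ x = 0 := fun x hx ↦ by
    by_contra hne
    exact hx (mem_of_mvfderiv_ne_zero hφR hne)
  have hoff : ∀ x, x ∉ tsupport φ \ e.far R → (ofRiemannian h).innerDual x
      (mvfderiv (𝓡 3) φ x).toLinearMap (mvfderiv (𝓡 3) φ₀ x).toLinearMap = 0 := fun x hx ↦ by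
    rw [hzero x hx]
    simp [PseudoRiemannianMetric.innerDual]
  -- the pairing is the pairing with the globalisation `f`
  have heq : (fun x ↦ (ofRiemannian h).innerDual x (mvfderiv (𝓡 3) φ x).toLinearMap
      (mvfderiv (𝓡 3) φ₀ x).toLinearMap) = fun x ↦ (ofRiemannian h).innerDual x
        (mvfderiv (𝓡 3) φ x).toLinearMap (mvfderiv (𝓡 3) f x).toLinearMap := by
    funext x
    by_cases hx : x ∈ V
    · rw [mvfderiv_congr_of_eventuallyEq (hfφ x hx)]
    · have hx' : x ∉ tsupport φ \ e.far R := fun h' ↦ hx (hKV h')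
      rw [hzero x hx']
      simp [PseudoRiemannianMetric.innerDual]
  refine ⟨?_, ?_, hoff⟩
  · rw [heq]
    exact continuous_innerDual_mvfderiv (ofRiemannian h) hφs hf
  · exact HasCompactSupport.intro' hK (hK.isClosed) hoff

end Pairing

/-! ### The pairing with a harmonic `φ₀` is the same for all comparison functions -/

section Constancy

variable [T2Space X] [LocallyCompactSpace X] [SigmaCompactSpace X] [MeasurableSpace X]
  [BorelSpace X] (h : ContMDiffRiemannianMetric (𝓡 3) ∞ E3 (TangentSpace (𝓡 3) : X → Type _))

/-- The pairing of a smooth comparison function (`tsupport φ ⊆ U`, `φ = 1` on `e.far R`) with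
`φ₀ ∈ C¹(U)` is integrable for the Riemannian measure (continuous with compact support,
`continuous_pairing_of_eqOn_far`). [folklore] -/
theorem integrable_pairing_of_eqOn_far (hU : IsExteriorRegion e U) {φ φ₀ : X → ℝ}
    (hφs : ContMDiff (𝓡 3) 𝓘(ℝ, ℝ) 1 φ) (hφU : tsupport φ ⊆ (U : Set X)) {R : ℝ}
    (hφR : ∀ x ∈ e.far R, φ x = 1) (hφ₀ : ContMDiffOn (𝓡 3) 𝓘(ℝ, ℝ) 1 φ₀ U) :
    Integrable (fun x ↦ (ofRiemannian h).innerDual x (mvfderiv (𝓡 3) φ x).toLinearMap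
      (mvfderiv (𝓡 3) φ₀ x).toLinearMap) (riemannianMeasure h) := by
  obtain ⟨hc, hcs, -⟩ := continuous_pairing_of_eqOn_far h hU hφs hφU hφR hφ₀
  exact integrable_of_continuous_of_hasCompactSupport h hc hcs

variable [(ofRiemannian h).HasLeviCivita]

/-- **The pairing `∫ h⁻¹(dφ, dφ₀)` with a harmonic `φ₀` does not depend on the comparison
function `φ`.** Let `U` be an exterior region of the end `e`, `φ₀ ∈ C²(U)` with `Δ_h φ₀ = 0` on
`U`, and `φ₁, φ₂` smooth on `X` with `tsupport φᵢ ⊆ U` and `φᵢ = 1` on far regions `e.far Rᵢ`.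
Then `∫_X h⁻¹(dφ₁, dφ₀) dV_h = ∫_X h⁻¹(dφ₂, dφ₀) dV_h`: the difference `ψ = φ₁ - φ₂` is smooth
with compact support in `U` (`tsupport ψ ⊆ closure U ∖ e.far (max R₁ R₂)`, compact for an
exterior region), so `∫ h⁻¹(dψ, dφ₀) = 0` by
`integral_innerDual_mvfderiv_eq_zero_of_dalembertian_eq_zero`. Bray 2001, §6 (the Green's
function (86) is critical for the energy). [cite: BrayRPI2001, §6 Def. 17 with (86)] -/
theorem integral_pairing_eq_of_eqOn_far (hU : IsExteriorRegion e U) {φ₀ : X → ℝ}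
    (hφ₀ : ContMDiffOn (𝓡 3) 𝓘(ℝ, ℝ) 2 φ₀ U)
    (hΔ : ∀ x ∈ (U : Set X), (ofRiemannian h).dalembertian φ₀ x = 0)
    {φ₁ φ₂ : X → ℝ} (h₁s : ContMDiff (𝓡 3) 𝓘(ℝ, ℝ) ∞ φ₁) (h₁U : tsupport φ₁ ⊆ (U : Set X))
    {R₁ : ℝ} (h₁R : ∀ x ∈ e.far R₁, φ₁ x = 1)
    (h₂s : ContMDiff (𝓡 3) 𝓘(ℝ, ℝ) ∞ φ₂) (h₂U : tsupport φ₂ ⊆ (U : Set X))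
    {R₂ : ℝ} (h₂R : ∀ x ∈ e.far R₂, φ₂ x = 1) :
    ∫ x, (ofRiemannian h).innerDual x (mvfderiv (𝓡 3) φ₁ x).toLinearMap
        (mvfderiv (𝓡 3) φ₀ x).toLinearMap ∂riemannianMeasure h =
      ∫ x, (ofRiemannian h).innerDual x (mvfderiv (𝓡 3) φ₂ x).toLinearMap
        (mvfderiv (𝓡 3) φ₀ x).toLinearMap ∂riemannianMeasure h := by
  have h1le : (1 : ℕ∞ω) ≤ ((⊤ : ℕ∞) : ℕ∞ω) := by exact_mod_cast le_top
  have hφ₀' : ContMDiffOn (𝓡 3) 𝓘(ℝ, ℝ) 1 φ₀ U := hφ₀.of_le (by norm_num)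
  -- the difference `ψ = φ₁ - φ₂` is smooth with compact support in `U`
  set ψ : X → ℝ := fun x ↦ φ₁ x - φ₂ x with hψ_def
  have hψs : ContMDiff (𝓡 3) 𝓘(ℝ, ℝ) 1 ψ := (h₁s.sub h₂s).of_le h1le
  have hψU : tsupport ψ ⊆ (U : Set X) := by
    refine (closure_mono (Function.support_sub φ₁ φ₂)).trans ?_
    rw [closure_union]
    exact union_subset h₁U h₂U
  have hψfar : tsupport ψ ⊆ (e.far (max R₁ R₂))ᶜ := by
    refine closure_minimal (fun x hx hxfar ↦ hx ?_) (e.isOpen_far _).isClosed_compl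
    simp only [hψ_def, h₁R x (e.far_mono (le_max_left _ _) hxfar),
      h₂R x (e.far_mono (le_max_right _ _) hxfar), sub_self]
  have hψc : HasCompactSupport ψ :=
    (hU.isCompact_closure_diff_far (max R₁ R₂)).of_isClosed_subset (isClosed_tsupport ψ)
      fun x hx ↦ ⟨(hψU.trans subset_closure) hx, hψfar hx⟩
  have key := integral_innerDual_mvfderiv_eq_zero_of_dalembertian_eq_zero h U.isOpen hφ₀ hΔ
    hψs hψc hψU
  -- pointwise, `h⁻¹(dψ, dφ₀) = h⁻¹(dφ₁, dφ₀) - h⁻¹(dφ₂, dφ₀)`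
  have hpt : (fun x ↦ (ofRiemannian h).innerDual x (mvfderiv (𝓡 3) ψ x).toLinearMap
      (mvfderiv (𝓡 3) φ₀ x).toLinearMap) = fun x ↦
      (ofRiemannian h).innerDual x (mvfderiv (𝓡 3) φ₁ x).toLinearMap
        (mvfderiv (𝓡 3) φ₀ x).toLinearMap -
      (ofRiemannian h).innerDual x (mvfderiv (𝓡 3) φ₂ x).toLinearMap
        (mvfderiv (𝓡 3) φ₀ x).toLinearMap := by
    funext x
    rw [hψ_def, mvfderiv_fun_sub ((h₁s x).mdifferentiableAt (by simp))
      ((h₂s x).mdifferentiableAt (by simp)), ContinuousLinearMap.toLinearMap_sub,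
      innerDual_sub_left]
  rw [hpt, integral_sub (integrable_pairing_of_eqOn_far h hU (h₁s.of_le h1le) h₁U h₁R hφ₀')
    (integrable_pairing_of_eqOn_far h hU (h₂s.of_le h1le) h₂U h₂R hφ₀')] at key
  linarith

end Constancy

/-! ### Double truncations of the potential and dominated convergence -/

section Potential

omit [IsManifold (𝓡 3) ∞ X] in
/-- **Double truncations of a test function are comparison functions.** For a test function
`φ₀` and a double truncation `W` (`W = 0` on `[-δ, δ]`, `W = 1` on `[1 - δ, 1 + δ]`, `δ > 0`,
smooth), `W ∘ φ₀` is smooth on `X`, has `tsupport (W ∘ φ₀) ⊆ {δ ≤ |φ₀|} ⊆ U`, and equals `1`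
on a far region of the end (where `|1 - φ₀| < δ`). [folklore] -/
theorem IsCapacityTestFn.doubleTrunc_mem {φ₀ : X → ℝ} (hφ₀ : IsCapacityTestFn e U φ₀)
    {δ : ℝ} (hδ : 0 < δ) {W : ℝ → ℝ} (hWs : ContDiff ℝ ∞ W) (hW0 : ∀ s, |s| ≤ δ → W s = 0)
    (hW1 : ∀ s, |1 - s| ≤ δ → W s = 1) :
    ContMDiff (𝓡 3) 𝓘(ℝ, ℝ) ∞ (W ∘ φ₀) ∧ tsupport (W ∘ φ₀) ⊆ (U : Set X) ∧
      ∃ R, e.R ≤ R ∧ ∀ x ∈ e.far R, (W ∘ φ₀) x = 1 := by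
  refine ⟨hφ₀.contMDiff_real_comp hδ hWs hW0, ?_, ?_⟩
  · have h1 : tsupport (W ∘ φ₀) ⊆ {x | δ ≤ |φ₀ x|} := by
      refine closure_minimal (fun x hx ↦ ?_)
        (isClosed_le continuous_const (continuous_abs.comp hφ₀.continuous))
      by_contra hlt
      exact hx (hW0 _ (le_of_lt (not_le.1 hlt)))
    refine h1.trans fun x hx ↦ ?_
    by_contra hxU
    have h0 : φ₀ x = 0 := hφ₀.2.2.1 x hxU
    have h2 : δ ≤ |φ₀ x| := hx
    rw [h0, abs_zero] at h2
    exact absurd h2 (not_le.2 hδ)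
  · obtain ⟨R, hR, hfar⟩ := hφ₀.tendstoAtEnd.exists_radius_abs_sub_lt hδ
    exact ⟨R, hR, fun x hx ↦ hW1 _ (le_of_lt (hfar x hx))⟩

variable [T2Space X] [LocallyCompactSpace X] [MeasurableSpace X] [BorelSpace X]
  (h : ContMDiffRiemannianMetric (𝓡 3) ∞ E3 (TangentSpace (𝓡 3) : X → Type _))

end Potential

/-! ### Energies of functions supported in `U` -/

section Energies

variable [T2Space X] [LocallyCompactSpace X] [MeasurableSpace X] [BorelSpace X]
  (h : ContMDiffRiemannianMetric (𝓡 3) ∞ E3 (TangentSpace (𝓡 3) : X → Type _))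

omit [T2Space X] [LocallyCompactSpace X] [MeasurableSpace X] [BorelSpace X] in
/-- The slope of a function vanishes off its topological support. [folklore] -/
theorem gradNorm_eq_zero_of_notMem_tsupport {φ : X → ℝ} {x : X} (hx : x ∉ tsupport φ) :
    gradNorm h φ x = 0 :=
  gradNorm_eq_zero_of_eventuallyEq_const h (c := 0) (notMem_tsupport_iff_eventuallyEq.1 hx)

/-- **The energy of a function supported in `U` is its energy over `U`.** [folklore] -/
theorem dirichletEnergy_eq_setLIntegral_of_tsupport_subset {φ : X → ℝ} {V : Set X}
    (hV : MeasurableSet V) (hφV : tsupport φ ⊆ V) :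
    dirichletEnergy h φ = ∫⁻ x in V, ENNReal.ofReal (gradNorm h φ x ^ 2) ∂riemannianMeasure h := by
  rw [dirichletEnergy, ← lintegral_indicator hV]
  refine lintegral_congr fun x ↦ ?_
  by_cases hx : x ∈ V
  · rw [indicator_of_mem hx]
  · rw [indicator_of_notMem hx, gradNorm_eq_zero_of_notMem_tsupport h fun h' ↦ hx (hφV h')]
    simp

end Energies

/-! ### Main theorem: `ℰ(Σ, g) = (1/2π) ∫_U |∇φ₀|²` for the harmonic potential `φ₀` -/

section Main

variable [T2Space X] [LocallyCompactSpace X] [SigmaCompactSpace X] [MeasurableSpace X]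
  [BorelSpace X] (h : ContMDiffRiemannianMetric (𝓡 3) ∞ E3 (TangentSpace (𝓡 3) : X → Type _))
  [(ofRiemannian h).HasLeviCivita]

/-- **A sequence of double truncations.** There are `C ≥ 0`, scales `δ n > 0` and smooth
`W n : ℝ → ℝ` with `W n = 0` on `[-δ n, δ n]`, `W n = 1` on `[1 - δ n, 1 + δ n]`, `|W n'| ≤ C`, and
`W n'(s) = 1` for all large `n` at each `s ∈ (0, 1)` (`exists_smooth_doubleTruncation` at the
scales `δ n = 1 / (8 (n + 1))`). [folklore] -/
theorem exists_doubleTrunc_seq : ∃ C : ℝ, 0 ≤ C ∧ ∃ (δ : ℕ → ℝ) (W : ℕ → ℝ → ℝ),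
    (∀ n, 0 < δ n) ∧ (∀ n, ContDiff ℝ ∞ (W n)) ∧ (∀ n s, |s| ≤ δ n → W n s = 0) ∧
    (∀ n s, |1 - s| ≤ δ n → W n s = 1) ∧ (∀ n s, |deriv (W n) s| ≤ C) ∧
    ∀ s, 0 < s → s < 1 → ∀ᶠ n in atTop, deriv (W n) s = 1 := by
  obtain ⟨C, hC0, hW⟩ := exists_smooth_doubleTruncation
  set δ : ℕ → ℝ := fun n ↦ 1 / (8 * (n + 1)) with hδ_def
  have hδ : ∀ n, 0 < δ n := fun n ↦ by positivity
  have hδ8 : ∀ n, δ n ≤ 1 / 8 := fun n ↦ by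
    rw [hδ_def, div_le_div_iff₀ (by positivity) (by positivity)]
    nlinarith [n.cast_nonneg (α := ℝ)]
  have hδle : ∀ N n : ℕ, N ≤ n → 2 * δ n ≤ 1 / ((N : ℝ) + 1) := fun N n hn ↦ by
    have hNn : (N : ℝ) ≤ n := Nat.cast_le.2 hn
    have h8 : 2 * δ n = 1 / (4 * ((n : ℝ) + 1)) := by
      simp only [hδ_def]
      field_simp
      ring
    rw [h8, div_le_div_iff₀ (by positivity) (by positivity)]
    nlinarith
  choose W hWs hW0 hW1 hWid hWC using fun n ↦ hW (δ n) (hδ n) (hδ8 n)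
  refine ⟨C, hC0, δ, W, hδ, hWs, hW0, hW1, hWC, fun s h0 h1 ↦ ?_⟩
  obtain ⟨N, hN⟩ := exists_nat_one_div_lt (lt_min h0 (sub_pos.2 h1))
  refine eventually_atTop.2 ⟨N, fun n hn ↦ hWid n _ ?_ ?_⟩
  · have h2 := hδle N n hn
    rw [abs_of_pos h0]
    linarith [min_le_left s (1 - s)]
  · have h2 := hδle N n hn
    rw [abs_of_pos (sub_pos.2 h1)]
    linarith [min_le_right s (1 - s)]

/-- **The pairing with the harmonic potential is its energy**: under the hypotheses of
`horizonCapacity_eq_of_harmonic` below, every smooth comparison function `φ` (`tsupport φ ⊆ U`,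
`φ = 1` on a far region) has `∫_X h⁻¹(dφ, dφ₀) dV_h = ∫_U |∇φ₀|²_h dV_h`. Proof: the pairing is
the same for all comparison functions (`integral_pairing_eq_of_eqOn_far`), and on the double
truncations `W n ∘ φ₀` it equals `∫_U W n'(φ₀) |∇φ₀|² → ∫_U |∇φ₀|²` (dominated convergence).
This is the weak form of "`φ₀` is the Green's function (86)": `∫_U ⟨∇φ, ∇φ₀⟩ = ∫_U |∇φ₀|²`, i.e.
`∫_U ⟨∇(φ - φ₀), ∇φ₀⟩ = 0`, obtained without boundary integrals.
[cite: BrayRPI2001, §6 Def. 17 with (86)] -/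
theorem integral_pairing_eq_setIntegral_of_harmonic (hU : IsExteriorRegion e U) {φ₀ : X → ℝ}
    (hφ₀ : IsCapacityTestFn e U φ₀)
    (hΔ : ∀ x ∈ (U : Set X), (ofRiemannian h).dalembertian φ₀ x = 0)
    (h01 : ∀ x ∈ (U : Set X), 0 < φ₀ x ∧ φ₀ x < 1)
    (hfin : ∫⁻ x in (U : Set X), ENNReal.ofReal (gradNorm h φ₀ x ^ 2) ∂riemannianMeasure h < ⊤)
    {φ : X → ℝ} (hφs : ContMDiff (𝓡 3) 𝓘(ℝ, ℝ) ∞ φ) (hφU : tsupport φ ⊆ (U : Set X)) {R : ℝ}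
    (hφR : ∀ x ∈ e.far R, φ x = 1) :
    ∫ x, (ofRiemannian h).innerDual x (mvfderiv (𝓡 3) φ x).toLinearMap
        (mvfderiv (𝓡 3) φ₀ x).toLinearMap ∂riemannianMeasure h =
      ∫ x in (U : Set X), gradNorm h φ₀ x ^ 2 ∂riemannianMeasure h := by
  -- notation: `μ`, `g = |∇φ₀|²`, the pairing `P φ = h⁻¹(dφ, dφ₀)`
  set μ : Measure X := riemannianMeasure h with hμ_def
  set g : X → ℝ := fun x ↦ gradNorm h φ₀ x ^ 2 with hg_def
  set P : (X → ℝ) → X → ℝ := fun φ x ↦ (ofRiemannian h).innerDual x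
    (mvfderiv (𝓡 3) φ x).toLinearMap (mvfderiv (𝓡 3) φ₀ x).toLinearMap with hP_def
  have hUo : IsOpen (U : Set X) := U.isOpen
  have hUm : MeasurableSet (U : Set X) := hUo.measurableSet
  have h1le : (1 : ℕ∞ω) ≤ ((⊤ : ℕ∞) : ℕ∞ω) := by exact_mod_cast le_top
  have h2le : (2 : ℕ∞ω) ≤ ((⊤ : ℕ∞) : ℕ∞ω) := WithTop.coe_le_coe.mpr le_top
  have hφ₀1 : ContMDiffOn (𝓡 3) 𝓘(ℝ, ℝ) 1 φ₀ U := hφ₀.contMDiffOn.of_le h1le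
  have hφ₀2 : ContMDiffOn (𝓡 3) 𝓘(ℝ, ℝ) 2 φ₀ U := hφ₀.contMDiffOn.of_le h2le
  have hφ₀d : ∀ x ∈ (U : Set X), MDifferentiableAt (𝓡 3) 𝓘(ℝ, ℝ) φ₀ x := fun x hx ↦
    (hφ₀.contMDiffOn.contMDiffAt (hUo.mem_nhds hx)).mdifferentiableAt (by simp)
  -- `g` is continuous and integrable on `U`
  have hgc : ContinuousOn g U := by
    have hg' : g = fun x ↦ (ofRiemannian h).innerDual x (mvfderiv (𝓡 3) φ₀ x).toLinearMap
        (mvfderiv (𝓡 3) φ₀ x).toLinearMap := funext fun x ↦ gradNorm_sq_eq_innerDual_mvfderiv h φ₀ x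
    rw [hg']
    exact continuousOn_innerDual_mvfderiv h hUo hφ₀1 hφ₀1
  have hg0 : ∀ x, 0 ≤ g x := fun x ↦ sq_nonneg _
  have hgi : Integrable g (μ.restrict U) :=
    ⟨hgc.aestronglyMeasurable hUm,
      (hasFiniteIntegral_iff_ofReal (Eventually.of_forall hg0)).2 hfin⟩
  -- the double truncations `ψ n = W n ∘ φ₀`
  obtain ⟨C, -, δ, W, hδ, hWs, hW0, hW1, hWC, hWev⟩ := exists_doubleTrunc_seq
  have hWd : ∀ n s, HasDerivAt (W n) (deriv (W n) s) s := fun n s ↦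
    (((hWs n).differentiable (by simp)) s).hasDerivAt
  have hWc : ∀ n, Continuous (deriv (W n)) := fun n ↦ (hWs n).continuous_deriv (by simp)
  have hmem := fun n ↦ hφ₀.doubleTrunc_mem (hδ n) (hWs n) (hW0 n) (hW1 n)
  have hψs : ∀ n, ContMDiff (𝓡 3) 𝓘(ℝ, ℝ) ∞ (W n ∘ φ₀) := fun n ↦ (hmem n).1
  have hψU : ∀ n, tsupport (W n ∘ φ₀) ⊆ (U : Set X) := fun n ↦ (hmem n).2.1
  choose Rn hRn hψR using fun n ↦ (hmem n).2.2
  -- `P (ψ n) = W n'(φ₀) g` on `U`, and `∫_U W n'(φ₀) g → ∫_U g`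
  have hPψ : ∀ n, ∀ x ∈ (U : Set X), P (W n ∘ φ₀) x = deriv (W n) (φ₀ x) * g x :=
    fun n x hx ↦ innerDual_mvfderiv_real_comp h (hWd n (φ₀ x)) (hφ₀d x hx)
  have hmeas : ∀ n, AEStronglyMeasurable (fun x ↦ deriv (W n) (φ₀ x) * g x) (μ.restrict U) :=
    fun n ↦ ((((hWc n).comp hφ₀.continuous).continuousOn).mul hgc).aestronglyMeasurable hUm
  have hlim : Tendsto (fun n ↦ ∫ x in (U : Set X), deriv (W n) (φ₀ x) * g x ∂μ) atTop
      (𝓝 (∫ x in (U : Set X), g x ∂μ)) :=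
    tendsto_setIntegral_mul_of_eventually_eq_one hUm hgi hmeas (fun n x ↦ hWC n (φ₀ x))
      fun x hx ↦ hWev _ (h01 x hx).1 (h01 x hx).2
  -- the pairing of `φ` equals the pairing of every `ψ n`
  have hn : ∀ n, ∫ x, P φ x ∂μ = ∫ x in (U : Set X), deriv (W n) (φ₀ x) * g x ∂μ := fun n ↦ by
    rw [hP_def, integral_pairing_eq_of_eqOn_far h hU hφ₀2 hΔ hφs hφU hφR (hψs n) (hψU n)
      (hψR n), ← setIntegral_eq_integral_of_forall_compl_eq_zero (s := (U : Set X))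
      (fun x hx ↦ ?_)]
    · exact setIntegral_congr_fun hUm fun x hx ↦ hPψ n x hx
    · rw [mvfderiv_eq_zero_of_notMem_tsupport fun h' ↦ hx (hψU n h')]
      simp [PseudoRiemannianMetric.innerDual]
  exact tendsto_nhds_unique (tendsto_const_nhds.congr hn) hlim

/-- **The capacity of a horizon is attained by its harmonic potential** (Bray 2001, §6, the
sentence after Def. 17: "the infimum … is achieved by the Green's function `φ(x)` which satisfies
(86) `lim_{x→∞} φ = 1`, `Δφ = 0`, `φ = 0` on `Σ`"). Let `U` be an exterior region of the end `e`
of the Riemannian `3`-manifold `(X, h)` and `φ₀` a test function (`IsCapacityTestFn e U φ₀`: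
continuous, smooth on `U`, zero on `Σ = ∂U` and inside, `→ 1` at infinity) which on `U` is
`h`-harmonic with `0 < φ₀ < 1` and has finite energy `∫_U |∇φ₀|² dV_h < ∞`. Then
`ℰ(Σ, g) = horizonCapacity h e U = (1/2π) ∫_U |∇φ₀|²_h dV_h`.
Existence and boundary regularity of the potential (86) are *not* asserted here; the theorem
identifies the capacity once it is given. Proof, without boundary integrals: by
`horizonCapacity_eq_iInf_eqOn_far` the capacity is the infimum of `(1/2π) ∫ |∇φ|²` over smooth
`φ` with `tsupport φ ⊆ U`, `φ = 1` far out; for such `φ` the pairing `L(φ) = ∫ h⁻¹(dφ, dφ₀)` is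
independent of `φ` (`integral_pairing_eq_of_eqOn_far`, Green's identity against the compactly
supported differences), and evaluating it on the double truncations `W_δ ∘ φ₀` (smooth, supported
in `U`, `= 1` far out) gives `L ≡ lim_δ ∫_U W_δ'(φ₀) |∇φ₀|² = ∫_U |∇φ₀|²` (dominated convergence,
`W_δ' → 1` on `(0, 1) ∋ φ₀`); hence `∫_U |∇φ|² = ∫_U |∇φ₀|² + 2 (L(φ) - ∫_U |∇φ₀|²) +
∫_U |∇(φ - φ₀)|² ≥ ∫_U |∇φ₀|²` (the Dirichlet principle), while
`∫ |∇(W_δ ∘ φ₀)|² = ∫_U W_δ'(φ₀)² |∇φ₀|² → ∫_U |∇φ₀|²` bounds the capacity from above.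
[cite: BrayRPI2001, §6 Def. 17 with (86)] -/
theorem horizonCapacity_eq_of_harmonic (hU : IsExteriorRegion e U) {φ₀ : X → ℝ}
    (hφ₀ : IsCapacityTestFn e U φ₀)
    (hΔ : ∀ x ∈ (U : Set X), (ofRiemannian h).dalembertian φ₀ x = 0)
    (h01 : ∀ x ∈ (U : Set X), 0 < φ₀ x ∧ φ₀ x < 1)
    (hfin : ∫⁻ x in (U : Set X), ENNReal.ofReal (gradNorm h φ₀ x ^ 2) ∂riemannianMeasure h < ⊤) :
    horizonCapacity h e U = ENNReal.ofReal (2 * π)⁻¹ *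
      ∫⁻ x in (U : Set X), ENNReal.ofReal (gradNorm h φ₀ x ^ 2) ∂riemannianMeasure h := by
  -- notation: `μ`, `g = |∇φ₀|²`, the pairing `P φ = h⁻¹(dφ, dφ₀)`
  set μ : Measure X := riemannianMeasure h with hμ_def
  set g : X → ℝ := fun x ↦ gradNorm h φ₀ x ^ 2 with hg_def
  set P : (X → ℝ) → X → ℝ := fun φ x ↦ (ofRiemannian h).innerDual x
    (mvfderiv (𝓡 3) φ x).toLinearMap (mvfderiv (𝓡 3) φ₀ x).toLinearMap with hP_def
  have hUo : IsOpen (U : Set X) := U.isOpen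
  have hUm : MeasurableSet (U : Set X) := hUo.measurableSet
  have h1le : (1 : ℕ∞ω) ≤ ((⊤ : ℕ∞) : ℕ∞ω) := by exact_mod_cast le_top
  have hφ₀1 : ContMDiffOn (𝓡 3) 𝓘(ℝ, ℝ) 1 φ₀ U := hφ₀.contMDiffOn.of_le h1le
  have hφ₀d : ∀ x ∈ (U : Set X), MDifferentiableAt (𝓡 3) 𝓘(ℝ, ℝ) φ₀ x := fun x hx ↦
    (hφ₀.contMDiffOn.contMDiffAt (hUo.mem_nhds hx)).mdifferentiableAt (by simp)
  -- `g` is continuous and integrable on `U`; `∫⁻_U g = ofReal (∫_U g)`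
  have hgc : ContinuousOn g U := by
    have hg' : g = fun x ↦ (ofRiemannian h).innerDual x (mvfderiv (𝓡 3) φ₀ x).toLinearMap
        (mvfderiv (𝓡 3) φ₀ x).toLinearMap := funext fun x ↦ gradNorm_sq_eq_innerDual_mvfderiv h φ₀ x
    rw [hg']
    exact continuousOn_innerDual_mvfderiv h hUo hφ₀1 hφ₀1
  have hg0 : ∀ x, 0 ≤ g x := fun x ↦ sq_nonneg _
  have hgi : Integrable g (μ.restrict U) :=
    ⟨hgc.aestronglyMeasurable hUm,
      (hasFiniteIntegral_iff_ofReal (Eventually.of_forall hg0)).2 hfin⟩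
  have hEU : ∫⁻ x in (U : Set X), ENNReal.ofReal (g x) ∂μ = ENNReal.ofReal (∫ x in (U : Set X), g x ∂μ) :=
    (ofReal_integral_eq_lintegral_ofReal hgi (Eventually.of_forall fun x ↦ hg0 x)).symm
  -- the double truncations `ψ n = W n ∘ φ₀`
  obtain ⟨C, -, δ, W, hδ, hWs, hW0, hW1, hWC, hWev⟩ := exists_doubleTrunc_seq
  have hWd : ∀ n s, HasDerivAt (W n) (deriv (W n) s) s := fun n s ↦
    (((hWs n).differentiable (by simp)) s).hasDerivAt
  have hWc : ∀ n, Continuous (deriv (W n)) := fun n ↦ (hWs n).continuous_deriv (by simp)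
  have hmem := fun n ↦ hφ₀.doubleTrunc_mem (hδ n) (hWs n) (hW0 n) (hW1 n)
  have hψs : ∀ n, ContMDiff (𝓡 3) 𝓘(ℝ, ℝ) ∞ (W n ∘ φ₀) := fun n ↦ (hmem n).1
  have hψU : ∀ n, tsupport (W n ∘ φ₀) ⊆ (U : Set X) := fun n ↦ (hmem n).2.1
  choose Rn hRn hψR using fun n ↦ (hmem n).2.2
  -- `|∇(ψ n)|² = W n'(φ₀)² g` on `U`, and `∫_U W n'(φ₀)² g → ∫_U g`
  have hEψ : ∀ n, ∀ x ∈ (U : Set X),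
      gradNorm h (W n ∘ φ₀) x ^ 2 = deriv (W n) (φ₀ x) ^ 2 * g x :=
    fun n x hx ↦ gradNorm_sq_real_comp h (hWd n (φ₀ x)) (hφ₀d x hx)
  have hmeas2 : ∀ n, AEStronglyMeasurable (fun x ↦ deriv (W n) (φ₀ x) ^ 2 * g x)
      (μ.restrict U) := fun n ↦
    (((((hWc n).comp hφ₀.continuous).pow 2).continuousOn).mul hgc).aestronglyMeasurable hUm
  have hlimE : Tendsto (fun n ↦ ∫ x in (U : Set X), deriv (W n) (φ₀ x) ^ 2 * g x ∂μ) atTop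
      (𝓝 (∫ x in (U : Set X), g x ∂μ)) := by
    refine tendsto_setIntegral_mul_of_eventually_eq_one hUm hgi hmeas2 (C := C ^ 2)
      (fun n x ↦ ?_) (fun x hx ↦ (hWev _ (h01 x hx).1 (h01 x hx).2).mono fun n hn ↦ by
        rw [hn, one_pow])
    rw [abs_pow]
    exact pow_le_pow_left₀ (abs_nonneg _) (hWC n (φ₀ x)) 2
  refine le_antisymm ?_ ?_
  · -- (C) upper bound through the double truncations
    have hbound : ∀ n, horizonCapacity h e U ≤ ENNReal.ofReal (2 * π)⁻¹ *
        ENNReal.ofReal (∫ x in (U : Set X), deriv (W n) (φ₀ x) ^ 2 * g x ∂μ) := fun n ↦ by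
      have h1 := horizonCapacity_le_of_contMDiff h e U (hψs n)
        (fun x hx ↦ image_eq_zero_of_notMem_tsupport fun h' ↦ hx (hψU n h'))
        (tendstoAtEnd_of_eqOn_far (hψR n))
      have hint : Integrable (fun x ↦ deriv (W n) (φ₀ x) ^ 2 * g x) (μ.restrict U) := by
        refine (hgi.norm.const_mul (C ^ 2)).mono' (hmeas2 n) (Eventually.of_forall fun x ↦ ?_)
        rw [norm_mul, Real.norm_eq_abs, abs_pow]
        exact mul_le_mul_of_nonneg_right (pow_le_pow_left₀ (abs_nonneg _) (hWC n (φ₀ x)) 2)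
          (norm_nonneg _)
      have h2 : dirichletEnergy h (W n ∘ φ₀) =
          ENNReal.ofReal (∫ x in (U : Set X), deriv (W n) (φ₀ x) ^ 2 * g x ∂μ) := by
        rw [dirichletEnergy_eq_setLIntegral_of_tsupport_subset h hUm (hψU n),
          ofReal_integral_eq_lintegral_ofReal hint (Eventually.of_forall fun x ↦
            mul_nonneg (sq_nonneg _) (hg0 x))]
        exact setLIntegral_congr_fun hUm fun x hx ↦ by rw [hEψ n x hx]
      rwa [h2] at h1
    have hl := ENNReal.Tendsto.const_mul (ENNReal.tendsto_ofReal hlimE)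
      (Or.inr ENNReal.ofReal_ne_top) (a := ENNReal.ofReal (2 * π)⁻¹)
    rw [← hEU] at hl
    exact ge_of_tendsto' hl hbound
  · -- (B) lower bound: the Dirichlet principle on the comparison class
    rw [horizonCapacity_eq_iInf_eqOn_far h e U]
    refine le_iInf₂ fun φ hφ ↦ ?_
    obtain ⟨hφs, hφU, R, -, hφR⟩ := hφ
    suffices hmain : ∫⁻ x in (U : Set X), ENNReal.ofReal (gradNorm h φ₀ x ^ 2) ∂μ ≤
        dirichletEnergy h φ by
      gcongr
    have hφ1 : ContMDiff (𝓡 3) 𝓘(ℝ, ℝ) 1 φ := hφs.of_le h1le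
    have hφd : ∀ x, MDifferentiableAt (𝓡 3) 𝓘(ℝ, ℝ) φ x := fun x ↦
      (hφs x).mdifferentiableAt (by simp)
    -- the energy density of `φ` is continuous with compact support
    set eφ : X → ℝ := fun x ↦ gradNorm h φ x ^ 2 with heφ_def
    have heφ' : eφ = fun x ↦ (ofRiemannian h).innerDual x (mvfderiv (𝓡 3) φ x).toLinearMap
        (mvfderiv (𝓡 3) φ x).toLinearMap := funext fun x ↦ gradNorm_sq_eq_innerDual_mvfderiv h φ x
    have heφc : Continuous eφ := by
      rw [heφ']
      exact continuous_innerDual_mvfderiv (ofRiemannian h) hφ1 hφ1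
    have heφs : HasCompactSupport eφ := by
      refine HasCompactSupport.intro' (hU.isCompact_tsupport_diff_far hφU R)
        ((hU.isCompact_tsupport_diff_far hφU R).isClosed) fun x hx ↦ ?_
      have h0 : mvfderiv (𝓡 3) φ x = 0 := by
        by_contra hne
        exact hx (mem_of_mvfderiv_ne_zero hφR hne)
      rw [heφ']
      simp [h0, PseudoRiemannianMetric.innerDual]
    have heφi : Integrable eφ (μ.restrict U) :=
      (integrable_of_continuous_of_hasCompactSupport h heφc heφs).integrableOn
    have hPi : Integrable (P φ) (μ.restrict U) :=
      (integrable_pairing_of_eqOn_far h hU hφ1 hφU hφR hφ₀1).integrableOn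
    -- `∫_U P φ = ∫_X P φ = ∫_U g`
    have hPU : ∫ x in (U : Set X), P φ x ∂μ = ∫ x in (U : Set X), g x ∂μ := by
      rw [setIntegral_eq_integral_of_forall_compl_eq_zero (fun x hx ↦ ?_)]
      · exact integral_pairing_eq_setIntegral_of_harmonic h hU hφ₀ hΔ h01 hfin hφs hφU hφR
      · change (ofRiemannian h).innerDual x (mvfderiv (𝓡 3) φ x).toLinearMap
          (mvfderiv (𝓡 3) φ₀ x).toLinearMap = 0
        rw [mvfderiv_eq_zero_of_notMem_tsupport fun h' ↦ hx (hφU h')]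
        simp [PseudoRiemannianMetric.innerDual]
    -- pointwise expansion on `U` and integrability of `|∇(φ - φ₀)|²` on `U`
    have hpt : ∀ x ∈ (U : Set X), eφ x = g x + 2 * (P φ x - g x) +
        gradNorm h (fun y ↦ φ y - φ₀ y) x ^ 2 := fun x hx ↦
      gradNorm_sq_expand h (hφd x) (hφ₀d x hx)
    have hdi : Integrable (fun x ↦ gradNorm h (fun y ↦ φ y - φ₀ y) x ^ 2) (μ.restrict U) := by
      refine ((heφi.sub hgi).sub ((hPi.sub hgi).const_mul 2)).congr ?_
      filter_upwards [ae_restrict_mem hUm] with x hx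
      have := hpt x hx
      simp only [Pi.sub_apply]
      linarith
    -- integrate: `∫_U |∇φ|² = ∫_U g + ∫_U |∇(φ - φ₀)|² ≥ ∫_U g`
    have hi1 : Integrable (fun x ↦ 2 * (P φ x - g x)) (μ.restrict U) := (hPi.sub hgi).const_mul 2
    have hi2 : Integrable (fun x ↦ g x + 2 * (P φ x - g x)) (μ.restrict U) := hgi.add hi1
    have hcross : ∫ x in (U : Set X), 2 * (P φ x - g x) ∂μ = 0 := by
      rw [integral_const_mul, integral_sub hPi hgi, hPU, sub_self, mul_zero]
    have hint : ∫ x in (U : Set X), eφ x ∂μ = ∫ x in (U : Set X), g x ∂μ +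
        ∫ x in (U : Set X), gradNorm h (fun y ↦ φ y - φ₀ y) x ^ 2 ∂μ := by
      calc ∫ x in (U : Set X), eφ x ∂μ
          = ∫ x in (U : Set X), (g x + 2 * (P φ x - g x)) +
              gradNorm h (fun y ↦ φ y - φ₀ y) x ^ 2 ∂μ := setIntegral_congr_fun hUm hpt
        _ = (∫ x in (U : Set X), g x + 2 * (P φ x - g x) ∂μ) +
              ∫ x in (U : Set X), gradNorm h (fun y ↦ φ y - φ₀ y) x ^ 2 ∂μ :=
            integral_add hi2 hdi
        _ = (∫ x in (U : Set X), g x ∂μ + ∫ x in (U : Set X), 2 * (P φ x - g x) ∂μ) +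
              ∫ x in (U : Set X), gradNorm h (fun y ↦ φ y - φ₀ y) x ^ 2 ∂μ := by
            rw [integral_add hgi hi1]
        _ = _ := by rw [hcross, add_zero]
    have hle : ∫ x in (U : Set X), g x ∂μ ≤ ∫ x in (U : Set X), eφ x ∂μ := by
      rw [hint]
      exact le_add_of_nonneg_right (setIntegral_nonneg hUm fun x _ ↦ sq_nonneg _)
    -- back to `ℝ≥0∞`
    rw [dirichletEnergy_eq_setLIntegral_of_tsupport_subset h hUm hφU, hEU,
      ← ofReal_integral_eq_lintegral_ofReal heφi (Eventually.of_forall fun x ↦ sq_nonneg _)]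
    exact ENNReal.ofReal_le_ofReal hle

/-- **The Dirichlet principle for the harmonic potential** (Bray 2001, §6: the Green's function
(86) "achieves the infimum" of Def. 17). Under the hypotheses of `horizonCapacity_eq_of_harmonic`,
every test function `φ` of the capacity has `∫_U |∇φ₀|² dV_h ≤ ∫_X |∇φ|² dV_h`.
[cite: BrayRPI2001, §6 Def. 17 with (86)] -/
theorem setLIntegral_gradNorm_sq_le_dirichletEnergy_of_harmonic (hU : IsExteriorRegion e U)
    {φ₀ : X → ℝ} (hφ₀ : IsCapacityTestFn e U φ₀)
    (hΔ : ∀ x ∈ (U : Set X), (ofRiemannian h).dalembertian φ₀ x = 0)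
    (h01 : ∀ x ∈ (U : Set X), 0 < φ₀ x ∧ φ₀ x < 1)
    (hfin : ∫⁻ x in (U : Set X), ENNReal.ofReal (gradNorm h φ₀ x ^ 2) ∂riemannianMeasure h < ⊤)
    {φ : X → ℝ} (hφ : IsCapacityTestFn e U φ) :
    ∫⁻ x in (U : Set X), ENNReal.ofReal (gradNorm h φ₀ x ^ 2) ∂riemannianMeasure h ≤
      dirichletEnergy h φ := by
  have h1 := horizonCapacity_le h e U hφ
  rw [horizonCapacity_eq_of_harmonic h hU hφ₀ hΔ h01 hfin] at h1
  exact (ENNReal.mul_le_mul_iff_right (ENNReal.ofReal_pos.2 (by positivity)).ne'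
    ENNReal.ofReal_ne_top).1 h1

/-- **`ℰ(Σ, g)` as a real number**: under the hypotheses of `horizonCapacity_eq_of_harmonic`,
`(horizonCapacity h e U).toReal = (1/2π) ∫_U |∇φ₀|²_h dV_h` (a Bochner integral; this is the form
in which `ℰ` enters `Bray2001_mass_ge_half_capacity`). [cite: BrayRPI2001, §6 Def. 17 with (86)] -/
theorem horizonCapacity_toReal_eq_of_harmonic (hU : IsExteriorRegion e U) {φ₀ : X → ℝ}
    (hφ₀ : IsCapacityTestFn e U φ₀)
    (hΔ : ∀ x ∈ (U : Set X), (ofRiemannian h).dalembertian φ₀ x = 0)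
    (h01 : ∀ x ∈ (U : Set X), 0 < φ₀ x ∧ φ₀ x < 1)
    (hfin : ∫⁻ x in (U : Set X), ENNReal.ofReal (gradNorm h φ₀ x ^ 2) ∂riemannianMeasure h < ⊤) :
    (horizonCapacity h e U).toReal =
      (2 * π)⁻¹ * ∫ x in (U : Set X), gradNorm h φ₀ x ^ 2 ∂riemannianMeasure h := by
  have hUo : IsOpen (U : Set X) := U.isOpen
  have h1le : (1 : ℕ∞ω) ≤ ((⊤ : ℕ∞) : ℕ∞ω) := by exact_mod_cast le_top
  have hφ₀1 : ContMDiffOn (𝓡 3) 𝓘(ℝ, ℝ) 1 φ₀ U := hφ₀.contMDiffOn.of_le h1le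
  have hgc : ContinuousOn (fun x ↦ gradNorm h φ₀ x ^ 2) U := by
    have hg' : (fun x ↦ gradNorm h φ₀ x ^ 2) = fun x ↦ (ofRiemannian h).innerDual x
        (mvfderiv (𝓡 3) φ₀ x).toLinearMap (mvfderiv (𝓡 3) φ₀ x).toLinearMap :=
      funext fun x ↦ gradNorm_sq_eq_innerDual_mvfderiv h φ₀ x
    rw [hg']
    exact continuousOn_innerDual_mvfderiv h hUo hφ₀1 hφ₀1
  have hg0 : ∀ x, 0 ≤ gradNorm h φ₀ x ^ 2 := fun x ↦ sq_nonneg _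
  have hgi : Integrable (fun x ↦ gradNorm h φ₀ x ^ 2) ((riemannianMeasure h).restrict U) :=
    ⟨hgc.aestronglyMeasurable hUo.measurableSet,
      (hasFiniteIntegral_iff_ofReal (Eventually.of_forall hg0)).2 hfin⟩
  rw [horizonCapacity_eq_of_harmonic h hU hφ₀ hΔ h01 hfin,
    ← ofReal_integral_eq_lintegral_ofReal hgi (Eventually.of_forall fun x ↦ hg0 x),
    ENNReal.toReal_mul, ENNReal.toReal_ofReal (by positivity),
    ENNReal.toReal_ofReal (setIntegral_nonneg hUo.measurableSet fun x _ ↦ hg0 x)]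

end Main

end Harmonic

end Literature.Geometry.Lorentzian

end
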